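import Summits.ResolutionOfSingularities.ResolutionOfSingularities.Theses.AbhyankarShadows
import Literature.AlgebraicGeometry.Resolution.TranscendentallyImmediate
import Literature.AlgebraicGeometry.Resolution.SeparablyDefectlessDenseDescent
import Literature.AlgebraicGeometry.Resolution.ValuedFunctionFieldsLemmas
import Literature.AlgebraicGeometry.Resolution.KnafKuhlmann2009Prop310
import Literature.AlgebraicGeometry.Resolution.LocalUniformizationEssFiniteType
import Literature.AlgebraicGeometry.Resolution.LocalUniformization
import Literature.AlgebraicGeometry.Resolution.AbhyankarRationalUniformization
import Literature.AlgebraicGeometry.Resolution.SmoothUniformization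
import Literature.AlgebraicGeometry.Resolution.KnafKuhlmann2009Assembly
import Literature.AlgebraicGeometry.Resolution.NormalizationFractions
import Literature.AlgebraicGeometry.Resolution.SubfieldTransport
import Literature.AlgebraicGeometry.Resolution.LocalUniformizationAbhyankarPlaces
import Literature.AlgebraicGeometry.Resolution.KnafKuhlmann2005Thm34Stability
import Literature.AlgebraicGeometry.Resolution.GeneralizedStabilityHolds
import Literature.AlgebraicGeometry.Resolution.ValuationDefect
import Literature.AlgebraicGeometry.Resolution.DefectTransport
import Literature.AlgebraicGeometry.Resolution.FiniteExtensionUniformizationProofs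
import Summits.ResolutionOfSingularities.ResolutionOfSingularities.Theorems.AbhyankarShadowsShadowsUniformizeDenseAlgStep
import Summits.ResolutionOfSingularities.ResolutionOfSingularities.Theorems.AbhyankarShadowsShadowsUniformizeLurelDenseAbhyankar
import Summits.ResolutionOfSingularities.ResolutionOfSingularities.Theorems.AbhyankarShadowsShadowsUniformizeLurelDiscrete
import Summits.ResolutionOfSingularities.ResolutionOfSingularities.Theorems.AbhyankarShadowsShadowsUniformizeComposite
import Summits.ResolutionOfSingularities.ResolutionOfSingularities.Theorems.AbhyankarShadowsShadowsUniformizeCompositeResidueDiscrete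
import Summits.ResolutionOfSingularities.ResolutionOfSingularities.Theorems.AbhyankarShadowsShadowsUniformizeResidueGen
import Summits.ResolutionOfSingularities.ResolutionOfSingularities.Theorems.AbhyankarShadowsShadowsUniformizeLurelComposite
import Summits.ResolutionOfSingularities.ResolutionOfSingularities.Theorems.AbhyankarShadowsShadowsUniformizeAbhyankarResidueTransport
import Summits.ResolutionOfSingularities.ResolutionOfSingularities.Theorems.AbhyankarShadowsShadowsUniformizeDenseResidueTransport
import Summits.ResolutionOfSingularities.ResolutionOfSingularities.Theorems.AbhyankarShadowsShadowsUniformizeCompositeResidueAbhyankar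
import Summits.ResolutionOfSingularities.ResolutionOfSingularities.Theorems.AbhyankarShadowsShadowsUniformizeCompositeResidueDense
import Literature.AlgebraicGeometry.Resolution.RankOneReductionProofs
import Literature.AlgebraicGeometry.Resolution.QuadraticTransformsProofs
import Literature.AlgebraicGeometry.Resolution.QuadraticTransformsRegular
import Literature.AlgebraicGeometry.Resolution.LocalBlowup
import Summits.ResolutionOfSingularities.ResolutionOfSingularities.Theorems.IndSmoothValuativeSmoothingQuadraticSequence
import Summits.ResolutionOfSingularities.ResolutionOfSingularities.Theorems.IndSmoothValuativeSmoothingSequenceCollapse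
import Summits.ResolutionOfSingularities.ResolutionOfSingularities.Theorems.IndSmoothValuativeSmoothingDominatesDimLeOne
import Summits.ResolutionOfSingularities.ResolutionOfSingularities.Theorems.AbhyankarShadowsShadowsUniformizeRegularCentreTransfer
import Summits.ResolutionOfSingularities.ResolutionOfSingularities.Theorems.AbhyankarShadowsShadowsUniformizePlaneRegularCentre
import Summits.ResolutionOfSingularities.ResolutionOfSingularities.Theorems.AbhyankarShadowsShadowsUniformizeRuledRegularCentre
import Summits.ResolutionOfSingularities.ResolutionOfSingularities.Theorems.AbhyankarShadowsShadowsUniformizeDiscreteIsDenseIn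
import Summits.ResolutionOfSingularities.ResolutionOfSingularities.Theorems.AbhyankarShadowsShadowsUniformizeDenseTranscStep
import Summits.ResolutionOfSingularities.ResolutionOfSingularities.Theorems.AbhyankarShadowsShadowsUniformizeUniformizerSeparating
import Summits.ResolutionOfSingularities.ResolutionOfSingularities.Theorems.AbhyankarShadowsShadowsUniformizePullback
import Summits.ResolutionOfSingularities.ResolutionOfSingularities.Theorems.AbhyankarShadowsShadowsUniformizeFrameQuotientEquiv
import Summits.ResolutionOfSingularities.ResolutionOfSingularities.Theorems.AbhyankarShadowsShadowsUniformizeShadowLocalRingRegular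
import Summits.ResolutionOfSingularities.ResolutionOfSingularities.Theorems.AbhyankarShadowsShadowsUniformizeRegularOfRegularQuotientCI
import HarnessLib

/-!
# Crux `ShadowsUniformize` (stmt-ResolutionOfSingularities-16756) — line `birth`, reshaped (leads c1, c2, c3)

## c3 reshape #4 (2026-08-17, cycle 4): the composite branch widened — residue valuation in ANY proved rational locus

Lead c3 replaces the composite-DISCRETE branch of c2 by the COMPOSITE-UNIFORMIZABLE branch
`lurelCompositeUniformizable`: `O` has a coarsening `O₁ ⊇ O` which is an Abhyankar place of
`K/k` or lies in the dense-Abhyankar locus, and the residue valuation `ν₂` of `ν_O = ν_{O₁} ∘ ν₂`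
(ring `residueValuationSubring O O₁ _` of `κ(O₁)`) is, read through a `k`-compatible
residue-field isomorphism `ι : κ → κ(O₁)`, DISCRETE (c2) or an ABHYANKAR place of `κ/k` or in
the DENSE-ABHYANKAR locus of `κ/k` (`IsCompositeUniformizable`). By the tree's proved
per-valuation Novacoski–Spivakovsky composition (`stub_lurel_of_composite`, landed c2) this needs
only relative LU of the residue valuation ring on `κ`, which is KK05 Thm. 1.1
(`relLU_at_abhyankarPlace_of_perfectField`, any residue field) resp. the c2 theorem
`lurelRational_of_isDenseAbhyankar` applied to the function field `κ/k` — plus the transport of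
the two residue-side predicates between the abstract residue fields handed over by the
composition lemma. New registered stubs: `stub_isAbhyankarPlace_residue_transport`,
`stub_isDenseAbhyankar_residue_transport` (plumbing along `κ ≅ κ(O₁) ≅ κ'`),
`stub_composite_residue_abhyankar`, `stub_composite_residue_dense` (the residue side), and the
lead's `stub_compositeUniformizableAssembly`. STATUS (end of c3 wave 1): ALL FOUR c3 stubs LANDED —
p167465, p167624, p167495, p167514 — and the typed assembly `lurelRational_of_isCompositeUniformizable`
(p168248); structural facts for the planner in `Theorems/…Structural.lean` (p167888:
`shadowsUniformize_iff_lurelRational_of_semivaluationShadows`, `lurel_of_trdeg_le_three` modulo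
`CossartPiltant2019LU3`). The core stub loses this locus (`hnU :
¬ IsCompositeUniformizable O` replaces `hnC`; `IsCompositeDiscrete O → IsCompositeUniformizable O`).
Example newly covered (neither Abhyankar, discrete, dense-Abhyankar nor composite-discrete):
`trdeg K = 4`, `O = O₁ ∘ ν₂` with `O₁` a prime divisor and `ν₂` a rank-one rational valuation of
the residue threefold `κ(O₁)` with value group `ℤ + ℤ√2` lying in the completion of an Abhyankar
surface subfield (`O` has rank 2 and rational rank 3; `K` is NOT dense over any Abhyankar
subfield `K₀`: density makes `K | K₀` immediate, so `trdeg K₀ = rr O = 3` and `κ(O₁ ∩ K₀)` is the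
whole residue threefold, whence `O₁ ∩ K₀` is trivial by Abhyankar's inequality on `K₀`,
contradicting `v(t) ∈ vK = vK₀`; and `O` is not composite-discrete since its only proper
coarsenings are `O₁`, with non-discrete residue valuation, and `K`).
What the core stub is, stays what the standing disprover ((A), (E), (H)) and leads c0–c2 found:
relative LU at rational places off the proved loci — the route target `LurelRational` on that
class (open from `trdeg 4`; `trdeg ≤ 3` in print, in the tree only as the named fact
`CossartPiltant2019LU3`).

## c2 reshape (2026-08-17): a THIRD proved locus — Knaf–Kuhlmann 2009 Thm. 1.5 in general

The discrete branch of c1 is the special case `F₀ = k(t)` of Knaf–Kuhlmann 2009, **Thm. 1.5**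
(case `P|_K = id`): "if `(F, P)` lies in the completion of a subfunction field `(F₀, P)` on which
`P` is an ABHYANKAR place, then `P` is strongly smoothly `K`-uniformizable" — Kuhlmann's places
"very close to Abhyankar places" ([K5]), in general NOT Abhyankar and NOT discrete. Lead c2 carves
this whole locus out of the core stub: `ShadowsUniformize_of` gets a third branch
`lurelDenseAbhyankar` (hypothesis: some finitely generated `K₀ ≤ K` with `O ∩ K₀` Abhyankar over
`k` and `K` dense over `K₀`), assembled (`stub_denseAbhyankarAssembly`, lead) from
* `stub_isAbhyankarPlace_map` — transport of `IsAbhyankarPlace` along `K ↪ K̄` (plumbing);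
* `stub_linDisjoint_of_dense_defectless` — the valuation-theoretic heart of KK09 **Lemma 3.12**
  ("every immediate extension of a defectless field is separable"): for `F₀ ≤ K'` dense and
  `(F₀, V ∩ F₀)` a defectless field, `F₀`-linearly independent elements of `K'` stay independent
  over `F₀(d)` for `dᵖ ∈ F₀` (fundamental inequality `linearIndependent_mul_of_valuation_of_residue`
  + `[F₀(d) : F₀] = e·f`); defectlessness of the Abhyankar `F₀` is the Generalized Stability
  Theorem, PROVED in the tree (`Kuhlmann2010Stability_holds`);
* `stub_separablyGenerated_of_linDisjoint` — Mac Lane's criterion (Mathlib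
  `exists_isTranscendenceBasis_and_isSeparable_of_linearIndepOn_pow_of_essFiniteType`) in the
  ambient vocabulary: hence `K' | F₀` is separably generated;
* `stub_separatingTower` — a separating transcendence basis of `K' | F₀` in tower form;
* `stub_denseTower_ambient` — KK09 **Prop. 3.11** over the Abhyankar base: KK05 Thm. 1.1
  (`KnafKuhlmann2005_Thm11_holds`) on `F₀`, then the landed dense steps (`stub_denseTranscStep`,
  `stub_denseAlgStep`) stacked by Cor. 3.6 — the c1 induction with a general base;
* `stub_pullback` (landed, c1).
The core stub keeps the complement (`¬ ∃ K₀, …`): rational places of `K/k` NOT in the completion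
of any Abhyankar subfunction field — exactly where Knaf–Kuhlmann's methods stop.
STATUS (end of c2 wave 1): ALL SIX dense-Abhyankar stubs LANDED — p160670 `stub_isAbhyankarPlace_map`,
p162032 `stub_linDisjoint_of_dense_defectless`, p161026 `stub_separablyGenerated_of_linDisjoint`,
p160702 `stub_separatingTower`, p160776 `stub_denseTower_ambient`, p162456 the assembly
(`knafKuhlmann2009_thm15_denseAbhyankar` ambient + `lurelRational_of_isDenseAbhyankar` typed, in
`Theorems/AbhyankarShadowsShadowsUniformizeLurelDenseAbhyankar.lean`); `lurelDenseAbhyankar` below is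
kernel-closed. RESHAPE #3 (same cycle): a FOURTH proved locus, the COMPOSITE-DISCRETE branch
`lurelCompositeDiscrete` (typed and LANDED as `lurelRational_of_isCompositeDiscrete`, p163740) — `O` has an Abhyankar / dense-Abhyankar coarsening `O₁` whose residue
valuation `ν₂` on `κ(O₁)` is discrete (e.g. value group `ℤ²` lex in transcendence degree `3`) — by
the tree's PROVED per-valuation Novacoski–Spivakovsky composition (`stub_lurel_of_composite`
p163332, `stub_composite_residue_discrete` p163499, `stub_residue_gen` p163456, assembly by the
lead). The ONLY `sorry` left in this file is the open core `stub_shadowFrameTransfer_core`, now off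
four proved loci.


Route `ResolutionOfSingularities/AbhyankarShadows`, crux #2 (rank 2, difficulty open-problem):
`ShadowsUniformize` = the TRANSFER half of Teissier's semivaluation conjecture
(arXiv:2311.12456 p. 5), typed by the planner as: `k` algebraically closed of characteristic
`p`, `K/k` finitely generated, `O` a RATIONAL valuation ring of `K/k`, `R ⊆ O` finitely
generated; IF every finite `F ⊆ R` admits a shadow of `(R, O)` exact on `F` (`HasShadows O R`
below, verbatim the crux hypothesis) THEN `R` is dominated by a finitely generated `A ⊆ O` with
`Frac A = K` which is regular at the centre of `O`.

## The cut after the c1 reshape: a case split on the value group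

The standing disprover (Cruxes/ShadowsUniformize/Disproof.lean, findings (B)–(C)) isolated the
IDENTITY-SHADOW LOCUS: when the value group of `O` is cyclic (a discrete rational place) the
hypothesis `HasShadows O R` is FREE (identity shadow; numerical semigroups are finitely
generated), so there the crux IS relative local uniformization at a discrete rational place —
TRUE in print (Knaf–Kuhlmann 2009, Thm. 1.5 / Prop. 3.11: `K` lies in the completion `k((t))`
of the Abhyankar subfield `k(t)`, `t` a uniformizer) and, as this skeleton shows, PROVABLE from
the tree's Knaf–Kuhlmann apparatus. `ShadowsUniformize_of` is therefore a case split on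
`IsCyclic (O.ValueGroup)ˣ`:

* DISCRETE BRANCH (`Sig.lurelDiscrete`, assembled in `lurelDiscrete_of` from five stubs):
  `O = K` is free (`lurel_of_essFiniteType`); otherwise pick a uniformizer `t`, embed
  `K ↪ Ω = K̄`, extend `O` to `V` (Chevalley), and prove that `K` is strongly smoothly
  `k`-uniformizable in the ambient rendering of `ValuedFunctionFields.lean`:
  - `stub_uniformizer_separating` — a separating transcendence basis `t', x₁, …, xₙ` of `K/k`
    whose first element has the value of `t` (differential criterion of
    `KnafKuhlmann2009Prop23.lean`; `t' = t + t^p w` if `dt = 0`), delivered as a TOWER: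
    `xᵢ` transcendental over `k(t', x_{<i})` and `K | k(t', x)` finite separable;
  - `stub_discrete_isDenseIn` — `k(t')` is DENSE in `K` (`IsDenseIn`): `t'`-adic expansions
    from rationality of `O` and cyclicity of the value group (KK09 p. 5: "`(F, P)` lies in the
    completion of `(F₀, P)`");
  - `stub_denseTranscStep` — KK09 Lemma 2.16 (completion case) + Lemma 3.9
    (`isSmoothlyUniformizableIn_of_immediate_of_kaplansky`): a dense transcendental step
    `E ≤ E(x)` is strongly smoothly `O_E`-uniformizable;
  - `stub_denseAlgStep` — KK09 §3.4 ("`L` must lie within the henselization of `K(T)`",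
    Lemma 3.7 (2)): a dense finite separable step `L ≤ F` is strongly smoothly
    `O_L`-uniformizable (Krasner `mem_of_isHenselianField_of_forall_exists_valuation_sub_lt`,
    `Kuhlmann2010HenselizationIsHenselian_holds`, Kuhlmann–Novacoski Hensel-root generator
    `KuhlmannNovacoski2014_Thm12_holds`, `isSmoothlyUniformizableIn_of_henselRoot`);
  - the base `k(t')` (`isSmoothlyUniformizableIn_rational`, KK05 Thm. 1.1 for `ρ = 1, τ = 0`)
    and the stacking along the tower (KK09 Cor. 3.6, `knafKuhlmann2009_cor36`) are done here;
  - `stub_pullback` — an ambient strongly-smoothly-`k`-uniformizable `K` gives, back in `K`,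
    a finitely generated regular model `A ⊇ R` (`exists_smooth_model`,
    `isRegularLocalRing_of_isSmoothAt`, pull-back along `K → Ω` as in `Cutkosky2022_Thm13_holds`).
* ABHYANKAR BRANCH: `relLU_at_abhyankarPlace_of_perfectField` (Knaf–Kuhlmann 2005 Thm. 1.1,
  PROVED in the tree) gives the conclusion outright.
* ON THE CORE LOCUS (value group not cyclic, place not Abhyankar) the transfer stub stays as
  registered at birth (`stub_shadowFrameTransfer_core`): shadows ⇒ a model with a toric shadow
  frame; the certifying half `regular_of_shadowFrame` (LANDED in cycle
  0: p150824, p151618, p152251) turns the frame into regularity. This stub is the open content of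
  the crux (Teissier's transfer, second half) and is conceded crux-sized on the typed hypothesis
  (junk scaled-arc shadows for `rr = 1`, refuter ATTACK §4); the line does not pretend otherwise.

Registered stubs after the reshape (c1 wave 1: `stub_discrete_isDenseIn` p156322,
`stub_uniformizer_separating` p156745, `stub_denseTranscStep` p156494, `stub_denseAlgStep` p156236,
`stub_pullback` p156263 — ALL LANDED; the lead's `stub_discreteAssembly` — degenerate case,
uniformizer, base, tower induction, transport — PROVED in this file, so the discrete branch
`lurelDiscrete` is a theorem): only `stub_shadowFrameTransfer_core` remains (off the discrete AND
off the ABHYANKAR locus, the latter settled by the tree's `relLU_at_abhyankarPlace_of_perfectField`).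

Disproof used: Disproof.lean (cdisprove cycle 1, 2026-08-17T10:04Z) findings (A) irrefutable,
(B) identity-shadow locus = discrete rational places with the hypothesis free — THIS is the locus
the discrete branch settles in-tree —, (C) [fg]/[exact] load-bearing; no `-- Targets` on file.
-/

noncomputable section

-- single-problem summit: the doubled namespace component `ResolutionOfSingularities` is forced
set_option linter.dupNamespace false

open Literature.AlgebraicGeometry.Resolution IsLocalRing
open Summit.ResolutionOfSingularities.ResolutionOfSingularities.Theses.AbhyankarShadows
  (ShadowsUniformize)

namespace Summit.ResolutionOfSingularities.ResolutionOfSingularities.Cruxes.ShadowsUniformize.Lines.Birth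

/-! ## The predicates of the cut -/

/-- **Shadows of `(R, O)` exact on every finite `F ⊆ R`** — VERBATIM the hypothesis of the crux
`AbhyankarShadows.ShadowsUniformize` (and the conclusion of its sister crux
`SemivaluationShadows`). [cite: arXiv:2311.12456, p. 5 (Conjecture)] -/
def HasShadows {k K : Type} [Field k] [Field K] [Algebra k K] (O : ValuationSubring K)
    (R : Subalgebra k K) : Prop :=
  ∀ F : Finset R, ∃ (R₁ : Subalgebra k K) (hle : R ≤ R₁) (_ : R₁.toSubring ≤ O.toSubring),
    R₁.FG ∧ IsFractionRing R₁ K ∧ ∃ (L : Type) (_ : Field L) (_ : Algebra k L) (φ : R₁ →ₐ[k] L)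
    (O' : ValuationSubring L), Module.finrank ℤ (Additive (O'.ValueGroup)ˣ) =
      Module.finrank ℤ (Additive (O.ValueGroup)ˣ) ∧ (∀ y : R₁, φ y ∈ O') ∧
    (∀ y : R₁, O'.valuation (φ y) < 1 ↔ O.valuation (y : K) < 1) ∧
    (∀ z : L, z ∈ O' → ∃ c : k, O'.valuation (z - algebraMap k L c) < 1) ∧
    (MonoidHom.mrange (O'.valuation.toMonoidWithZeroHom.toMonoidHom.comp
      φ.toRingHom.toMonoidHom)).FG ∧
    ∃ ι : O'.ValueGroup →*₀o O.ValueGroup, Function.Injective ι ∧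
      (∀ y : R₁, φ y ≠ 0 → ∃ y' : R₁, ι (O'.valuation (φ y)) = O.valuation (y' : K)) ∧
      ∀ x ∈ F, ι (O'.valuation (φ (Subalgebra.inclusion hle x))) = O.valuation ((x : R) : K)

/-- **Toric shadow frame** of an affine model `A ⊆ O` of `K/k` at the centre `𝔭 = 𝔪_O ∩ A` of
`O`: a shadow map `ψ : A →ₐ[k] L` into a field with a RATIONAL valuation ring `O' ⊇ ψ(A)` having
the SAME CENTRE as `O`; `r = ratRank O` elements `xᵢ ∈ A` whose images are value-independent for
`O'` and generate the maximal ideal of the shadow's local ring `D = ψ(A)_{𝔪_{O'} ∩ ψ(A)}`; and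
`(ker ψ)A_𝔭` generated by `height`-many elements (transversality).
[cite: arXiv:2311.12456, p. 5; arXiv:1401.5204, Thm. 4.3; KnafKuhlmann2005, Thm. 1.1] -/
def ToricShadowFrame {k K : Type} [Field k] [Field K] [Algebra k K] (O : ValuationSubring K)
    (A : Subalgebra k K) (h : A.toSubring ≤ O.toSubring) : Prop :=
  ∃ (L : Type) (_ : Field L) (_ : Algebra k L) (ψ : A →ₐ[k] L) (O' : ValuationSubring L)
    (hψ : ψ.range.toSubring ≤ O'.toSubring),
    (∀ z : L, z ∈ O' → ∃ c : k, O'.valuation (z - algebraMap k L c) < 1) ∧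
    (∀ a : A, O'.valuation (ψ a) < 1 ↔ O.valuation (a : K) < 1) ∧
    ∃ (r : ℕ) (x : Fin r → A),
      (r : Cardinal) = ratRank O ∧
      IsValueIndependent O' (fun i => ψ (x i)) ∧
      IsLocalRing.maximalIdeal
          (Localization.AtPrime (Ideal.comap (Subring.inclusion hψ) (IsLocalRing.maximalIdeal O'))) =
        Ideal.span (Set.range fun i => algebraMap ψ.range.toSubring
          (Localization.AtPrime (Ideal.comap (Subring.inclusion hψ) (IsLocalRing.maximalIdeal O')))
          ⟨ψ (x i), ψ.mem_range_self (x i)⟩) ∧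
      ∃ S : Finset (Localization.AtPrime
          (Ideal.comap (Subring.inclusion h) (IsLocalRing.maximalIdeal O))),
        Ideal.span (S : Set (Localization.AtPrime
          (Ideal.comap (Subring.inclusion h) (IsLocalRing.maximalIdeal O)))) =
          Ideal.map (algebraMap A.toSubring (Localization.AtPrime
            (Ideal.comap (Subring.inclusion h) (IsLocalRing.maximalIdeal O)))) (RingHom.ker ψ) ∧
        (S.card : ℕ∞) = (Ideal.map (algebraMap A.toSubring (Localization.AtPrime
            (Ideal.comap (Subring.inclusion h) (IsLocalRing.maximalIdeal O)))) (RingHom.ker ψ)).height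

/-! ## Sanity (proved): `HasShadows` is the crux hypothesis on the nose -/

/-- The crux unfolds to "`HasShadows O R` ⇒ a regular affine model dominating `R`", literally
(`Iff.rfl`). [folklore] -/
theorem shadowsUniformize_iff :
    ShadowsUniformize ↔
      ∀ p : ℕ, p.Prime → ∀ (k K : Type) [Field k] [CharP k p] [IsAlgClosed k] [Field K]
        [Algebra k K], (⊤ : IntermediateField k K).FG → ∀ O : ValuationSubring K,
        (∀ c : k, algebraMap k K c ∈ O) →
        (∀ x : K, x ∈ O → ∃ c : k, O.valuation (x - algebraMap k K c) < 1) →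
        ∀ R : Subalgebra k K, R.FG → R.toSubring ≤ O.toSubring → HasShadows O R →
        ∃ (A : Subalgebra k K) (h : A.toSubring ≤ O.toSubring), R ≤ A ∧ A.FG ∧
          IsFractionRing A K ∧ IsRegularLocalRing
            (Localization.AtPrime (Ideal.comap (Subring.inclusion h) (IsLocalRing.maximalIdeal O))) :=
  Iff.rfl

/-! ## The stub STATEMENTS by name (`Sig.<name>`) -/

/-- **The discrete branch** (relative local uniformization at a DISCRETE rational place over an
algebraically closed field: the crux on the identity-shadow locus, where `HasShadows` is free).
[cite: KnafKuhlmann2009, Thm. 1.5] -/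
def Sig.lurelDiscrete : Prop :=
  ∀ p : ℕ, p.Prime → ∀ (k K : Type) [Field k] [CharP k p] [IsAlgClosed k] [Field K]
    [Algebra k K], (⊤ : IntermediateField k K).FG → ∀ O : ValuationSubring K,
    (∀ c : k, algebraMap k K c ∈ O) →
    (∀ x : K, x ∈ O → ∃ c : k, O.valuation (x - algebraMap k K c) < 1) →
    IsCyclic (O.ValueGroup)ˣ →
    ∀ R : Subalgebra k K, R.FG → R.toSubring ≤ O.toSubring →
    ∃ (A : Subalgebra k K) (h : A.toSubring ≤ O.toSubring), R ≤ A ∧ A.FG ∧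
      IsFractionRing A K ∧ IsRegularLocalRing
        (Localization.AtPrime (Ideal.comap (Subring.inclusion h) (IsLocalRing.maximalIdeal O)))

/-- **The dense-Abhyankar locus** (lead c2): `O` restricted to some finitely generated
subextension `K₀` of `K/k` is an Abhyankar place of `K₀/k`, and `K` lies in the completion of
`(K₀, O ∩ K₀)` (`IsDenseIn`, computed inside `K` with `V := O`). [cite: KnafKuhlmann2009, Thm. 1.5] -/
def IsDenseAbhyankar {k K : Type} [Field k] [Field K] [Algebra k K] (O : ValuationSubring K) : Prop :=
  ∃ K₀ : IntermediateField k K, K₀.FG ∧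
    IsAbhyankarPlace O (algebraMap k K).fieldRange K₀.toSubfield ∧ IsDenseIn O K₀.toSubfield ⊤

/-- **The composite-discrete locus** (lead c2, reshape #3): `O` has a coarsening `O₁ ⊇ O` which is
an Abhyankar place of `K/k` or lies in the dense-Abhyankar locus, such that the residue valuation
`ν₂` of the decomposition `ν_O = ν_{O₁} ∘ ν₂` (ring `residueValuationSubring O O₁ _` of `κ(O₁)`)
has cyclic value group. Examples: value group `ℤ²` (lex) composed of a prime divisor of `K` and a
discrete rational place of its residue function field (transcendence degree `≥ 3`; neither
Abhyankar nor discrete). [cite: NovacoskiSpivakovsky2014, Thm. 1.1] -/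
def IsCompositeDiscrete {k K : Type} [Field k] [Field K] [Algebra k K] (O : ValuationSubring K) :
    Prop :=
  ∃ (O₁ : ValuationSubring K) (hO : O ≤ O₁),
    (IsAbhyankarPlace O₁ (algebraMap k K).fieldRange ⊤ ∨ IsDenseAbhyankar (k := k) O₁) ∧
    IsCyclic ((residueValuationSubring O O₁ hO).ValueGroup)ˣ

/-- **The composite-uniformizable locus** (lead c3, reshape #4): `O` has a coarsening `O₁ ⊇ O`
which is an Abhyankar place of `K/k` or lies in the dense-Abhyankar locus, such that the residue
valuation ring `O / m_{O₁}` of `κ(O₁)` (`residueValuationSubring O O₁ _`) EITHER has cyclic value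
group (the c2 locus `IsCompositeDiscrete`) OR, read through some `k`-compatible surjective (hence
bijective) `ι : κ → κ(O₁)` from a field `κ` with a `k`-algebra structure, is an Abhyankar place of
`κ/k` or lies in the dense-Abhyankar locus of `κ/k` (unfolded). Example beyond the c2 loci:
`trdeg K = 4`, `O₁` a prime divisor and `ν₂` a rank-one rational valuation of the residue
threefold with value group `ℤ + ℤ√2` in the completion of an Abhyankar surface subfield.
[cite: NovacoskiSpivakovsky2014, Thm. 1.1; KnafKuhlmann2005, Thm. 1.1; KnafKuhlmann2009, Thm. 1.5] -/
def IsCompositeUniformizable {k K : Type} [Field k] [Field K] [Algebra k K]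
    (O : ValuationSubring K) : Prop :=
  ∃ (O₁ : ValuationSubring K) (hO : O ≤ O₁),
    (IsAbhyankarPlace O₁ (algebraMap k K).fieldRange ⊤ ∨ IsDenseAbhyankar (k := k) O₁) ∧
    (IsCyclic ((residueValuationSubring O O₁ hO).ValueGroup)ˣ ∨
      ∃ (κ : Type) (_ : Field κ) (_ : Algebra k κ) (ι : κ →+* IsLocalRing.ResidueField O₁),
        Function.Surjective ι ∧
        (∀ (c : k) (hc : algebraMap k K c ∈ O₁),
          ι (algebraMap k κ c) = IsLocalRing.residue O₁ ⟨algebraMap k K c, hc⟩) ∧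
        (IsAbhyankarPlace ((residueValuationSubring O O₁ hO).comap ι)
            (algebraMap k κ).fieldRange ⊤ ∨
          ∃ κ₀ : IntermediateField k κ, κ₀.FG ∧
            IsAbhyankarPlace ((residueValuationSubring O O₁ hO).comap ι)
              (algebraMap k κ).fieldRange κ₀.toSubfield ∧
            IsDenseIn ((residueValuationSubring O O₁ hO).comap ι) κ₀.toSubfield ⊤))

/-- The c2 locus is part of the c3 locus. [folklore] -/
theorem IsCompositeDiscrete.isCompositeUniformizable {k K : Type} [Field k] [Field K]
    [Algebra k K] {O : ValuationSubring K} (h : IsCompositeDiscrete (k := k) O) :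
    IsCompositeUniformizable (k := k) O := by
  obtain ⟨O₁, hO, h₁, hcyc⟩ := h
  exact ⟨O₁, hO, h₁, Or.inl hcyc⟩

/-- **The regular-centre locus** (lead c3, reshape #5): `O` admits ABSOLUTE local
uniformization on SOME affine model with a centre of dimension `≤ 2` — there is a finitely
generated `B ⊆ O` with `Frac B = K` whose local ring at the centre `𝔪_O ∩ B` is regular of Krull
dimension `≤ 2`. By Abhyankar's union lemma (1956, Lemma 12; PROVED in the tree as
`AbhyankarQuadraticUnion_holds`) the quadratic transforms of that local ring along `O` exhaust
`O`, so relative local uniformization for EVERY finitely generated `R ⊆ O` follows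
(`stub_lurel_of_regularCentre`). Contains every valuation ring `O ∋ k` of the rational function
field `k(x, y)` (`stub_regularCentre_of_purelyTranscendental`); in transcendence degree `2` it is
exactly the locus where absolute local uniformization holds on one model (Zariski 1939 /
Abhyankar 1956). [cite: Abhyankar1956Valuations, Lemma 12] -/
def HasRegularCentreDimLeTwo {k K : Type} [Field k] [Field K] [Algebra k K]
    (O : ValuationSubring K) : Prop :=
  ∃ (B : Subalgebra k K) (h : B.toSubring ≤ O.toSubring), B.FG ∧ IsFractionRing B K ∧
    IsRegularLocalRing
      (Localization.AtPrime (Ideal.comap (Subring.inclusion h) (IsLocalRing.maximalIdeal O))) ∧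
    ringKrullDim
      (Localization.AtPrime (Ideal.comap (Subring.inclusion h) (IsLocalRing.maximalIdeal O))) ≤ 2

/-- Statement of `stub_lurel_of_regularCentre` (c3, reshape #5; the transfer from ONE regular
centre of dimension `≤ 2` to relative local uniformization for EVERY `R`): quadratic sequence
along `O` (`stub_quadraticSequence`), Abhyankar's union lemma (`AbhyankarQuadraticUnion_holds`),
collapse of the `N`-th transform to the local ring at the centre of a finitely generated
`B[t] ⊆ O` (`stub_sequenceCollapse`), regularity along the sequence
(`isRegularLocalRing_sequence`); dimension `≤ 1`: `O` is the centre's local ring itself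
(`stub_eqOfDominatesOfDimLeOne`). Any ground field. [cite: Abhyankar1956Valuations, Lemma 12] -/
def Sig.stub_lurel_of_regularCentre : Prop :=
  ∀ (k K : Type) [Field k] [Field K] [Algebra k K] (O : ValuationSubring K) (B : Subalgebra k K),
    B.FG → ∀ (hBO : B.toSubring ≤ O.toSubring), IsFractionRing B K →
    IsRegularLocalRing
      (Localization.AtPrime (Ideal.comap (Subring.inclusion hBO) (IsLocalRing.maximalIdeal O))) →
    ringKrullDim
      (Localization.AtPrime (Ideal.comap (Subring.inclusion hBO) (IsLocalRing.maximalIdeal O))) ≤ 2 →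
    ∀ R : Subalgebra k K, R.FG → R.toSubring ≤ O.toSubring →
    ∃ (A : Subalgebra k K) (h : A.toSubring ≤ O.toSubring), R ≤ A ∧ A.FG ∧
      IsFractionRing A K ∧ IsRegularLocalRing
        (Localization.AtPrime (Ideal.comap (Subring.inclusion h) (IsLocalRing.maximalIdeal O)))

/-- Statement of `stub_regularCentre_of_purelyTranscendental` (c3, reshape #5): every valuation
ring `O ∋ k` of the rational function field `K = k(x, y)` in two algebraically independent
generators has a regular centre of dimension `≤ 2` on an affine model: `B = k[x', y']` with
`x' ∈ {x, x⁻¹} ∩ O`, `y' ∈ {y, y⁻¹} ∩ O` is a polynomial ring (`x', y'` algebraically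
independent), hence regular (Mathlib `IsRegularRing (MvPolynomial _ k)`), of dimension `2`, with
`Frac B = K`. Any ground field. [folklore] -/
def Sig.stub_regularCentre_of_purelyTranscendental : Prop :=
  ∀ (k K : Type) [Field k] [Field K] [Algebra k K] (x y : K),
    AlgebraicIndependent k ![x, y] → IntermediateField.adjoin k {x, y} = ⊤ →
    ∀ O : ValuationSubring K, (∀ c : k, algebraMap k K c ∈ O) →
    ∃ (B : Subalgebra k K) (h : B.toSubring ≤ O.toSubring), B.FG ∧ IsFractionRing B K ∧
      IsRegularLocalRing
        (Localization.AtPrime (Ideal.comap (Subring.inclusion h) (IsLocalRing.maximalIdeal O))) ∧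
      ringKrullDim
        (Localization.AtPrime (Ideal.comap (Subring.inclusion h) (IsLocalRing.maximalIdeal O))) ≤ 2

/-- Statement of `stub_regularCentre_of_ruled` (c3, reshape #5b): every valuation ring `O ∋ k`
of a RULED function field `K = F(x)` — `F/k` finitely generated of transcendence degree `≤ 1`,
`x` transcendental over `F` — has a regular centre of dimension `≤ 2` on an affine model:
`B = A₁[x']` with `x' ∈ {x, x⁻¹} ∩ O` and `A₁ ⊆ O ∩ F` a finitely generated model of `F`
regular at the centre of `O ∩ F` (local uniformization in dimension one = finite
normalization, `exists_closure_isRegularLocalRing_of_ringKrullDim_le_one`; or `A₁` any model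
when `O ⊇ F`); `B ≅ A₁[X]`, and a localization of a polynomial ring over a regular local ring
at a prime over the maximal ideal is regular
(`Polynomial.isRegularLocalRing_localization_atPrime_of_comap_eq_maximalIdeal`). [folklore] -/
def Sig.stub_regularCentre_of_ruled : Prop :=
  ∀ (k K : Type) [Field k] [Field K] [Algebra k K] (F : IntermediateField k K), F.FG →
    Algebra.trdeg k F ≤ 1 → ∀ x : K, Transcendental F x → IntermediateField.adjoin F {x} = ⊤ →
    ∀ O : ValuationSubring K, (∀ c : k, algebraMap k K c ∈ O) →
    ∃ (B : Subalgebra k K) (h : B.toSubring ≤ O.toSubring), B.FG ∧ IsFractionRing B K ∧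
      IsRegularLocalRing
        (Localization.AtPrime (Ideal.comap (Subring.inclusion h) (IsLocalRing.maximalIdeal O))) ∧
      ringKrullDim
        (Localization.AtPrime (Ideal.comap (Subring.inclusion h) (IsLocalRing.maximalIdeal O))) ≤ 2

/-- **Relative local uniformization for ruled surfaces, typed**: `K = F(x)` with `F/k` a
finitely generated extension of transcendence degree `≤ 1` and `x` transcendental over `F`;
EVERY valuation ring `O ∋ k` of `K` and every finitely generated `R ⊆ O` admit a finitely
generated `A` with `R ≤ A ⊆ O`, `Frac A = K`, regular at the centre. [folklore] -/
def Sig.lurelRuled : Prop :=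
  ∀ (k K : Type) [Field k] [Field K] [Algebra k K] (F : IntermediateField k K), F.FG →
    Algebra.trdeg k F ≤ 1 → ∀ x : K, Transcendental F x → IntermediateField.adjoin F {x} = ⊤ →
    ∀ O : ValuationSubring K, (∀ c : k, algebraMap k K c ∈ O) →
    ∀ R : Subalgebra k K, R.FG → R.toSubring ≤ O.toSubring →
    ∃ (A : Subalgebra k K) (h : A.toSubring ≤ O.toSubring), R ≤ A ∧ A.FG ∧
      IsFractionRing A K ∧ IsRegularLocalRing
        (Localization.AtPrime (Ideal.comap (Subring.inclusion h) (IsLocalRing.maximalIdeal O)))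

/-- **The regular-centre branch, typed** (relative local uniformization at every valuation ring
— rational or not, any ground field — admitting absolute local uniformization with a centre of
dimension `≤ 2` on some affine model). [cite: Abhyankar1956Valuations, Lemma 12] -/
def Sig.lurelRegularCentre : Prop :=
  ∀ (k K : Type) [Field k] [Field K] [Algebra k K] (O : ValuationSubring K),
    HasRegularCentreDimLeTwo (k := k) O →
    ∀ R : Subalgebra k K, R.FG → R.toSubring ≤ O.toSubring →
    ∃ (A : Subalgebra k K) (h : A.toSubring ≤ O.toSubring), R ≤ A ∧ A.FG ∧
      IsFractionRing A K ∧ IsRegularLocalRing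
        (Localization.AtPrime (Ideal.comap (Subring.inclusion h) (IsLocalRing.maximalIdeal O)))

/-- **Relative local uniformization for the rational function field in two variables, typed**:
for ANY field `k`, `K = k(x, y)` with `x, y` algebraically independent, EVERY valuation ring
`O ∋ k` of `K` and every finitely generated `R ⊆ O` admit a finitely generated `A` with
`R ≤ A ⊆ O`, `Frac A = K`, regular at the centre of `O` (Zariski's local uniformization of the
plane along an arbitrary valuation, all characteristics, relative form).
[cite: Abhyankar1956Valuations, Lemma 12] -/
def Sig.lurelPurelyTranscendentalTwo : Prop :=
  ∀ (k K : Type) [Field k] [Field K] [Algebra k K] (x y : K),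
    AlgebraicIndependent k ![x, y] → IntermediateField.adjoin k {x, y} = ⊤ →
    ∀ O : ValuationSubring K, (∀ c : k, algebraMap k K c ∈ O) →
    ∀ R : Subalgebra k K, R.FG → R.toSubring ≤ O.toSubring →
    ∃ (A : Subalgebra k K) (h : A.toSubring ≤ O.toSubring), R ≤ A ∧ A.FG ∧
      IsFractionRing A K ∧ IsRegularLocalRing
        (Localization.AtPrime (Ideal.comap (Subring.inclusion h) (IsLocalRing.maximalIdeal O)))

/-- Statement of `stub_regularCentreAssembly` (the c3 lead's second stub: the transfer and the
plane give the regular-centre branch and the `k(x, y)` theorem). [cite: Abhyankar1956Valuations, Lemma 12] -/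
def Sig.stub_regularCentreAssembly : Prop :=
  Sig.stub_lurel_of_regularCentre → Sig.stub_regularCentre_of_purelyTranscendental →
    Sig.lurelRegularCentre ∧ Sig.lurelPurelyTranscendentalTwo

/-- Statement of `stub_shadowFrameTransfer_core`: on the CORE locus (value group not cyclic,
place not Abhyankar, `K` not in the completion of any Abhyankar subfunction field (c2), `O` not
composite over an Abhyankar / dense-Abhyankar coarsening with discrete, Abhyankar or
dense-Abhyankar residue valuation (c3 #4), and — c3 #5 — `O` admitting NO regular centre of
dimension `≤ 2` on any affine model, i.e. in transcendence degree `2` exactly where absolute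
local uniformization is not yet a theorem of the tree), shadows exact on every finite `F` give
an affine model `A ⊇ R` inside `O`, `Frac A = K`, carrying a toric shadow frame at the centre
of `O`. [cite: arXiv:2311.12456, p. 5 (Conjecture, transfer half)] -/
def Sig.stub_shadowFrameTransfer_core : Prop :=
  ∀ p : ℕ, p.Prime → ∀ (k K : Type) [Field k] [CharP k p] [IsAlgClosed k] [Field K]
    [Algebra k K], (⊤ : IntermediateField k K).FG → ∀ O : ValuationSubring K,
    (∀ c : k, algebraMap k K c ∈ O) →
    (∀ x : K, x ∈ O → ∃ c : k, O.valuation (x - algebraMap k K c) < 1) →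
    ¬ IsCyclic (O.ValueGroup)ˣ → ¬ IsAbhyankarPlace O (algebraMap k K).fieldRange ⊤ →
    ¬ IsDenseAbhyankar (k := k) O → ¬ IsCompositeUniformizable (k := k) O →
    ¬ HasRegularCentreDimLeTwo (k := k) O →
    ∀ R : Subalgebra k K, R.FG → R.toSubring ≤ O.toSubring → HasShadows O R →
    ∃ (A : Subalgebra k K) (h : A.toSubring ≤ O.toSubring), R ≤ A ∧ A.FG ∧
      IsFractionRing A K ∧ ToricShadowFrame O A h

/-- **The composite-uniformizable branch, typed** (relative local uniformization at the rational
places of `K/k` composed of an Abhyankar / dense-Abhyankar coarsening and a residue valuation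
that is discrete, Abhyankar or dense-Abhyankar). [cite: NovacoskiSpivakovsky2014, Thm. 1.1;
KnafKuhlmann2005, Thm. 1.1; KnafKuhlmann2009, Thm. 1.5] -/
def Sig.lurelCompositeUniformizable : Prop :=
  ∀ p : ℕ, p.Prime → ∀ (k K : Type) [Field k] [CharP k p] [IsAlgClosed k] [Field K]
    [Algebra k K], (⊤ : IntermediateField k K).FG → ∀ O : ValuationSubring K,
    (∀ c : k, algebraMap k K c ∈ O) →
    (∀ x : K, x ∈ O → ∃ c : k, O.valuation (x - algebraMap k K c) < 1) →
    IsCompositeUniformizable (k := k) O →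
    ∀ R : Subalgebra k K, R.FG → R.toSubring ≤ O.toSubring →
    ∃ (A : Subalgebra k K) (h : A.toSubring ≤ O.toSubring), R ≤ A ∧ A.FG ∧
      IsFractionRing A K ∧ IsRegularLocalRing
        (Localization.AtPrime (Ideal.comap (Subring.inclusion h) (IsLocalRing.maximalIdeal O)))

/-- Statement of `stub_isAbhyankarPlace_residue_transport` (c3): the Abhyankar property of a
valuation ring of `L` read through two `k`-compatible field ISOMORPHISMS `ι : κ → L`,
`ι' : κ' → L` (surjective homomorphisms of fields) is the same on `κ/k` and on `κ'/k`
(transport along `ι'⁻¹ ∘ ι`, `isAbhyankarPlace_map`). [folklore] -/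
def Sig.stub_isAbhyankarPlace_residue_transport : Prop :=
  ∀ (k κ κ' L : Type) [Field k] [Field κ] [Field κ'] [Field L] [Algebra k κ] [Algebra k κ']
    (W : ValuationSubring L) (ι : κ →+* L) (ι' : κ' →+* L),
    Function.Surjective ι → Function.Surjective ι' →
    (∀ c : k, ι (algebraMap k κ c) = ι' (algebraMap k κ' c)) →
    IsAbhyankarPlace (W.comap ι) (algebraMap k κ).fieldRange ⊤ →
    IsAbhyankarPlace (W.comap ι') (algebraMap k κ').fieldRange ⊤

/-- Statement of `stub_isDenseAbhyankar_residue_transport` (c3): the dense-Abhyankar property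
(unfolded: some finitely generated `κ₀ ≤ κ` on which the place is Abhyankar, with `κ` dense
over `κ₀`) read through two `k`-compatible field isomorphisms `ι : κ → L`, `ι' : κ' → L` is the
same on `κ/k` and on `κ'/k`. [folklore] -/
def Sig.stub_isDenseAbhyankar_residue_transport : Prop :=
  ∀ (k κ κ' L : Type) [Field k] [Field κ] [Field κ'] [Field L] [Algebra k κ] [Algebra k κ']
    (W : ValuationSubring L) (ι : κ →+* L) (ι' : κ' →+* L),
    Function.Surjective ι → Function.Surjective ι' →
    (∀ c : k, ι (algebraMap k κ c) = ι' (algebraMap k κ' c)) →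
    (∃ κ₀ : IntermediateField k κ, κ₀.FG ∧
      IsAbhyankarPlace (W.comap ι) (algebraMap k κ).fieldRange κ₀.toSubfield ∧
      IsDenseIn (W.comap ι) κ₀.toSubfield ⊤) →
    ∃ κ₀' : IntermediateField k κ', κ₀'.FG ∧
      IsAbhyankarPlace (W.comap ι') (algebraMap k κ').fieldRange κ₀'.toSubfield ∧
      IsDenseIn (W.comap ι') κ₀'.toSubfield ⊤

/-- Statement of `stub_composite_residue_abhyankar` (c3; the residue side, Abhyankar case): if
the residue valuation ring `O / m_{O₁}`, read through a `k`-compatible surjective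
`ι : κ → κ(O₁)`, is an ABHYANKAR place of `κ/k`, then `ι⁻¹(O / m_{O₁})` admits relative local
uniformization over `k` (`κ/k` is finitely generated by `hgen`; Knaf–Kuhlmann 2005 Thm. 1.1 on
`κ`, any residue field: `relLU_at_abhyankarPlace_of_perfectField`).
[cite: KnafKuhlmann2005, Thm. 1.1 and Cor. 2.2] -/
def Sig.stub_composite_residue_abhyankar : Prop :=
  ∀ (k K : Type) [Field k] [IsAlgClosed k] [Field K] [Algebra k K]
    (O O₁ : ValuationSubring K) (hO : O ≤ O₁) (hk : ∀ c : k, algebraMap k K c ∈ O),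
    (∃ S : Finset O, ∀ T : Subfield (IsLocalRing.ResidueField O₁),
      (∀ c : k, IsLocalRing.residue O₁ ⟨algebraMap k K c, hO (hk c)⟩ ∈ T) →
      (∀ s ∈ S, IsLocalRing.residue O₁ ⟨(s : K), hO s.2⟩ ∈ T) → T = ⊤) →
    ∀ (κ : Type) [Field κ] [Algebra k κ] (ι : κ →+* IsLocalRing.ResidueField O₁),
      Function.Surjective ι →
      (∀ c : k, ι (algebraMap k κ c) = IsLocalRing.residue O₁ ⟨algebraMap k K c, hO (hk c)⟩) →
      IsAbhyankarPlace ((residueValuationSubring O O₁ hO).comap ι)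
        (algebraMap k κ).fieldRange ⊤ →
      ∀ R : Subalgebra k κ, R.FG →
        R.toSubring ≤ ((residueValuationSubring O O₁ hO).comap ι).toSubring →
        ∃ (B : Subalgebra k κ) (hB : B.toSubring ≤ ((residueValuationSubring O O₁ hO).comap ι).toSubring),
          R ≤ B ∧ B.FG ∧ IsRegularLocalRing (Localization.AtPrime (Ideal.comap (Subring.inclusion hB)
            (IsLocalRing.maximalIdeal ((residueValuationSubring O O₁ hO).comap ι))))

/-- Statement of `stub_composite_residue_dense` (c3; the residue side, dense-Abhyankar case): if
the residue valuation ring `O / m_{O₁}`, read through a `k`-compatible surjective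
`ι : κ → κ(O₁)`, lies in the DENSE-ABHYANKAR locus of `κ/k` (unfolded), then `ι⁻¹(O / m_{O₁})`
admits relative local uniformization over `k` (`κ/k` finitely generated by `hgen`, `char κ = p`;
the c2 theorem `lurelRational_of_isDenseAbhyankar` on `κ`). [cite: KnafKuhlmann2009, Thm. 1.5] -/
def Sig.stub_composite_residue_dense : Prop :=
  ∀ (p : ℕ), p.Prime → ∀ (k K : Type) [Field k] [CharP k p] [IsAlgClosed k] [Field K]
    [Algebra k K] (O O₁ : ValuationSubring K) (hO : O ≤ O₁) (hk : ∀ c : k, algebraMap k K c ∈ O),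
    (∃ S : Finset O, ∀ T : Subfield (IsLocalRing.ResidueField O₁),
      (∀ c : k, IsLocalRing.residue O₁ ⟨algebraMap k K c, hO (hk c)⟩ ∈ T) →
      (∀ s ∈ S, IsLocalRing.residue O₁ ⟨(s : K), hO s.2⟩ ∈ T) → T = ⊤) →
    ∀ (κ : Type) [Field κ] [Algebra k κ] (ι : κ →+* IsLocalRing.ResidueField O₁),
      Function.Surjective ι →
      (∀ c : k, ι (algebraMap k κ c) = IsLocalRing.residue O₁ ⟨algebraMap k K c, hO (hk c)⟩) →
      (∃ κ₀ : IntermediateField k κ, κ₀.FG ∧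
        IsAbhyankarPlace ((residueValuationSubring O O₁ hO).comap ι)
          (algebraMap k κ).fieldRange κ₀.toSubfield ∧
        IsDenseIn ((residueValuationSubring O O₁ hO).comap ι) κ₀.toSubfield ⊤) →
      ∀ R : Subalgebra k κ, R.FG →
        R.toSubring ≤ ((residueValuationSubring O O₁ hO).comap ι).toSubring →
        ∃ (B : Subalgebra k κ) (hB : B.toSubring ≤ ((residueValuationSubring O O₁ hO).comap ι).toSubring),
          R ≤ B ∧ B.FG ∧ IsRegularLocalRing (Localization.AtPrime (Ideal.comap (Subring.inclusion hB)
            (IsLocalRing.maximalIdeal ((residueValuationSubring O O₁ hO).comap ι))))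

/-- Statement of `stub_compositeUniformizableAssembly` (the c3 lead's stub: the composition, the
discrete residue side and the residue-field generation of c2, the two transports and the two new
residue sides give the composite-uniformizable branch). [cite: NovacoskiSpivakovsky2014, Thm. 1.1] -/
def Sig.stub_compositeUniformizableAssembly : Prop :=
  Sig.stub_isAbhyankarPlace_residue_transport → Sig.stub_isDenseAbhyankar_residue_transport →
    Sig.stub_composite_residue_abhyankar → Sig.stub_composite_residue_dense →
    Sig.lurelCompositeUniformizable

/-- **The dense-Abhyankar branch, typed** (relative local uniformization at the rational places of
`K/k` lying in the completion of an Abhyankar subfunction field; `k` algebraically closed).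
[cite: KnafKuhlmann2009, Thm. 1.5] -/
def Sig.lurelDenseAbhyankar : Prop :=
  ∀ p : ℕ, p.Prime → ∀ (k K : Type) [Field k] [CharP k p] [IsAlgClosed k] [Field K]
    [Algebra k K], (⊤ : IntermediateField k K).FG → ∀ O : ValuationSubring K,
    (∀ c : k, algebraMap k K c ∈ O) → IsDenseAbhyankar (k := k) O →
    ∀ R : Subalgebra k K, R.FG → R.toSubring ≤ O.toSubring →
    ∃ (A : Subalgebra k K) (h : A.toSubring ≤ O.toSubring), R ≤ A ∧ A.FG ∧
      IsFractionRing A K ∧ IsRegularLocalRing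
        (Localization.AtPrime (Ideal.comap (Subring.inclusion h) (IsLocalRing.maximalIdeal O)))

/-- Statement of `stub_isAbhyankarPlace_map` (transport of the Abhyankar property of a place along
a field embedding compatible with the valuation rings). [folklore] -/
def Sig.stub_isAbhyankarPlace_map : Prop :=
  ∀ {Ω Ω' : Type} [Field Ω] [Field Ω'] (ι : Ω →+* Ω') {V : ValuationSubring Ω}
    {V' : ValuationSubring Ω'}, V'.comap ι = V → ∀ {K F : Subfield Ω},
    IsAbhyankarPlace V K F → IsAbhyankarPlace V' (K.map ι) (F.map ι)

/-- Statement of `stub_linDisjoint_of_dense_defectless` (KK09 Lemma 3.12, valuation-theoretic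
heart: a dense extension of a defectless field is linearly disjoint from the purely inseparable
extensions of exponent one). [cite: KnafKuhlmann2009, Lemma 3.12] -/
def Sig.stub_linDisjoint_of_dense_defectless : Prop :=
  ∀ {Ω : Type} [Field Ω] [IsAlgClosed Ω] (V : ValuationSubring Ω) (p : ℕ) [Fact p.Prime]
    [CharP Ω p] (F₀ K' : Subfield Ω), F₀ ≤ K' → IsDenseIn V F₀ K' →
    IsDefectlessField F₀ (V.comap (algebraMap F₀ Ω)) →
    ∀ (n : ℕ) (d s : Fin n → Ω), (∀ i, d i ^ p ∈ F₀) → (∀ i, s i ∈ K') →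
    LinearIndependent F₀ s → ∑ i, d i * s i = 0 → ∀ i, d i = 0

/-- Statement of `stub_separablyGenerated_of_linDisjoint` (Mac Lane's criterion, ambient form:
linear disjointness from `F₀^{1/p}` makes the finitely generated `K' | F₀` separably generated).
[folklore] -/
def Sig.stub_separablyGenerated_of_linDisjoint : Prop :=
  ∀ {Ω : Type} [Field Ω] [IsAlgClosed Ω] (p : ℕ) [Fact p.Prime] [CharP Ω p]
    (F₀ K' : Subfield Ω), F₀ ≤ K' → FGOver F₀ K' →
    (∀ (n : ℕ) (d s : Fin n → Ω), (∀ i, d i ^ p ∈ F₀) → (∀ i, s i ∈ K') →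
      LinearIndependent F₀ s → ∑ i, d i * s i = 0 → ∀ i, d i = 0) →
    SeparablyGeneratedOver F₀ K'

/-- Statement of `stub_separatingTower` (a separating transcendence basis in tower form).
[folklore] -/
def Sig.stub_separatingTower : Prop :=
  ∀ {Ω : Type} [Field Ω] (F₀ K' : Subfield Ω), F₀ ≤ K' → FGOver F₀ K' →
    SeparablyGeneratedOver F₀ K' →
    ∃ (n : ℕ) (x : Fin n → Ω), (∀ i, x i ∈ K') ∧
      (∀ i : Fin n, ∀ P : Polynomial Ω,
        (∀ m, P.coeff m ∈ Subfield.closure ((F₀ : Set Ω) ∪ x '' {j | j < i})) →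
        P.eval (x i) = 0 → P = 0) ∧
      FiniteSeparableOver (Subfield.closure ((F₀ : Set Ω) ∪ Set.range x)) K'

/-- Statement of `stub_denseTower_ambient` (KK09 Prop. 3.11 over an Abhyankar base: KK05 Thm. 1.1
on `F₀`, dense transcendental and separable-algebraic steps up a separating tower, stacked by
Cor. 3.6). [cite: KnafKuhlmann2009, Prop. 3.11 and Thm. 1.5] -/
def Sig.stub_denseTower_ambient : Prop :=
  ∀ {Ω : Type} [Field Ω] [IsAlgClosed Ω] (V : ValuationSubring Ω) (k' F₀ K' : Subfield Ω)
    [PerfectField k'], k' ≤ F₀ → F₀ ≤ K' → FGOver k' F₀ → (k' : Set Ω) ⊆ V →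
    IsAbhyankarPlace V k' F₀ → IsDenseIn V F₀ K' →
    ∀ (n : ℕ) (x : Fin n → Ω), (∀ i, x i ∈ K') →
    (∀ i : Fin n, ∀ P : Polynomial Ω,
      (∀ m, P.coeff m ∈ Subfield.closure ((F₀ : Set Ω) ∪ x '' {j | j < i})) →
      P.eval (x i) = 0 → P = 0) →
    FiniteSeparableOver (Subfield.closure ((F₀ : Set Ω) ∪ Set.range x)) K' →
    ∀ Z : Finset Ω, (∀ z ∈ Z, z ∈ V ∧ z ∈ K') →
    IsSmoothlyUniformizableIn ↥(V.toSubring ⊓ k'.toSubring) V K' (Z : Set Ω)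

/-- **The composite-discrete branch, typed** (relative local uniformization at the rational places
of `K/k` composed of a uniformizable coarsening and a discrete residue valuation).
[cite: NovacoskiSpivakovsky2014, Thm. 1.1; KnafKuhlmann2009, Thm. 1.5] -/
def Sig.lurelCompositeDiscrete : Prop :=
  ∀ p : ℕ, p.Prime → ∀ (k K : Type) [Field k] [CharP k p] [IsAlgClosed k] [Field K]
    [Algebra k K], (⊤ : IntermediateField k K).FG → ∀ O : ValuationSubring K,
    (∀ c : k, algebraMap k K c ∈ O) →
    (∀ x : K, x ∈ O → ∃ c : k, O.valuation (x - algebraMap k K c) < 1) →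
    IsCompositeDiscrete (k := k) O →
    ∀ R : Subalgebra k K, R.FG → R.toSubring ≤ O.toSubring →
    ∃ (A : Subalgebra k K) (h : A.toSubring ≤ O.toSubring), R ≤ A ∧ A.FG ∧
      IsFractionRing A K ∧ IsRegularLocalRing
        (Localization.AtPrime (Ideal.comap (Subring.inclusion h) (IsLocalRing.maximalIdeal O)))

/-- Statement of `stub_lurel_of_composite` (Novacoski–Spivakovsky's composition `ν = ν₁ ∘ ν₂`,
per valuation, in the crux's affine-model shape). [cite: NovacoskiSpivakovsky2014, Thm. 1.1 (§3.1)] -/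
def Sig.stub_lurel_of_composite : Prop :=
  ∀ (k K : Type) [Field k] [Field K] [Algebra k K], (⊤ : IntermediateField k K).FG →
    ∀ (O O₁ : ValuationSubring K) (hO : O ≤ O₁) (hk : ∀ c : k, algebraMap k K c ∈ O),
    (∃ S : Finset O, ∀ T : Subfield (IsLocalRing.ResidueField O₁),
      (∀ c : k, IsLocalRing.residue O₁ ⟨algebraMap k K c, hO (hk c)⟩ ∈ T) →
      (∀ s ∈ S, IsLocalRing.residue O₁ ⟨(s : K), hO s.2⟩ ∈ T) → T = ⊤) →
    (∀ R : Subalgebra k K, R.FG → R.toSubring ≤ O₁.toSubring →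
      ∃ (A : Subalgebra k K) (h : A.toSubring ≤ O₁.toSubring), R ≤ A ∧ A.FG ∧
        IsFractionRing A K ∧ IsRegularLocalRing
          (Localization.AtPrime (Ideal.comap (Subring.inclusion h) (IsLocalRing.maximalIdeal O₁)))) →
    (∀ (κ : Type) [Field κ] [Algebra k κ] (ι : κ →+* IsLocalRing.ResidueField O₁),
      Function.Surjective ι →
      (∀ c : k, ι (algebraMap k κ c) = IsLocalRing.residue O₁ ⟨algebraMap k K c, hO (hk c)⟩) →
      ∀ R : Subalgebra k κ, R.FG →
        R.toSubring ≤ ((residueValuationSubring O O₁ hO).comap ι).toSubring →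
        ∃ (B : Subalgebra k κ) (hB : B.toSubring ≤ ((residueValuationSubring O O₁ hO).comap ι).toSubring),
          R ≤ B ∧ B.FG ∧ IsRegularLocalRing (Localization.AtPrime (Ideal.comap (Subring.inclusion hB)
            (IsLocalRing.maximalIdeal ((residueValuationSubring O O₁ hO).comap ι))))) →
    ∀ R : Subalgebra k K, R.FG → R.toSubring ≤ O.toSubring →
    ∃ (A : Subalgebra k K) (h : A.toSubring ≤ O.toSubring), R ≤ A ∧ A.FG ∧
      IsFractionRing A K ∧ IsRegularLocalRing
        (Localization.AtPrime (Ideal.comap (Subring.inclusion h) (IsLocalRing.maximalIdeal O)))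

/-- Statement of `stub_composite_residue_discrete` (the residue side: a DISCRETE rational residue
valuation `ν₂` of `κ(O₁) ≅ κ`, read through a `k`-compatible isomorphism `ι`, admits relative local
uniformization — `lurelRational_of_isCyclic_valueGroup` transported). [cite: KnafKuhlmann2009, Thm. 1.5] -/
def Sig.stub_composite_residue_discrete : Prop :=
  ∀ p : ℕ, p.Prime → ∀ (k K : Type) [Field k] [CharP k p] [IsAlgClosed k] [Field K]
    [Algebra k K] (O O₁ : ValuationSubring K) (hO : O ≤ O₁) (hk : ∀ c : k, algebraMap k K c ∈ O),
    (∀ x : K, x ∈ O → ∃ c : k, O.valuation (x - algebraMap k K c) < 1) →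
    (∃ S : Finset O, ∀ T : Subfield (IsLocalRing.ResidueField O₁),
      (∀ c : k, IsLocalRing.residue O₁ ⟨algebraMap k K c, hO (hk c)⟩ ∈ T) →
      (∀ s ∈ S, IsLocalRing.residue O₁ ⟨(s : K), hO s.2⟩ ∈ T) → T = ⊤) →
    IsCyclic ((residueValuationSubring O O₁ hO).ValueGroup)ˣ →
    ∀ (κ : Type) [Field κ] [Algebra k κ] (ι : κ →+* IsLocalRing.ResidueField O₁),
      Function.Surjective ι →
      (∀ c : k, ι (algebraMap k κ c) = IsLocalRing.residue O₁ ⟨algebraMap k K c, hO (hk c)⟩) →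
      ∀ R : Subalgebra k κ, R.FG →
        R.toSubring ≤ ((residueValuationSubring O O₁ hO).comap ι).toSubring →
        ∃ (B : Subalgebra k κ) (hB : B.toSubring ≤ ((residueValuationSubring O O₁ hO).comap ι).toSubring),
          R ≤ B ∧ B.FG ∧ IsRegularLocalRing (Localization.AtPrime (Ideal.comap (Subring.inclusion hB)
            (IsLocalRing.maximalIdeal ((residueValuationSubring O O₁ hO).comap ι))))

/-- Statement of `stub_residue_gen` (the residue field of an Abhyankar / dense-Abhyankar coarsening
`O₁ ⊇ O` is generated over `k` by the residues of finitely many elements of `O`).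
[cite: KnafKuhlmann2005, Cor. 2.2] -/
def Sig.stub_residue_gen : Prop :=
  ∀ (k K : Type) [Field k] [IsAlgClosed k] [Field K] [Algebra k K], (⊤ : IntermediateField k K).FG →
    ∀ (O O₁ : ValuationSubring K) (hO : O ≤ O₁) (hk : ∀ c : k, algebraMap k K c ∈ O),
    (IsAbhyankarPlace O₁ (algebraMap k K).fieldRange ⊤ ∨ IsDenseAbhyankar (k := k) O₁) →
    ∃ S : Finset O, ∀ T : Subfield (IsLocalRing.ResidueField O₁),
      (∀ c : k, IsLocalRing.residue O₁ ⟨algebraMap k K c, hO (hk c)⟩ ∈ T) →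
      (∀ s ∈ S, IsLocalRing.residue O₁ ⟨(s : K), hO s.2⟩ ∈ T) → T = ⊤

/-- Statement of `stub_compositeAssembly` (the c2 lead's second stub: the three composite stub
statements give the composite-discrete branch). [cite: NovacoskiSpivakovsky2014, Thm. 1.1] -/
def Sig.stub_compositeAssembly : Prop :=
  Sig.stub_lurel_of_composite → Sig.stub_composite_residue_discrete → Sig.stub_residue_gen →
    Sig.lurelCompositeDiscrete

/-- Statement of `stub_discrete_isDenseIn` (KK09 p. 5, "lies in the completion"; here: the
rational function field of a uniformizer is dense). [cite: KnafKuhlmann2009, Thm. 1.5] -/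
def Sig.stub_discrete_isDenseIn : Prop :=
  ∀ {Ω : Type} [Field Ω] (V : ValuationSubring Ω) (k' K' : Subfield Ω) (t : Ω),
    k' ≤ K' → (k' : Set Ω) ⊆ V → t ∈ K' → V.valuation t < 1 →
    (∀ y ∈ K', y ∈ V → ∃ c ∈ k', V.valuation (y - c) < 1) →
    (∀ y ∈ K', y ≠ 0 → ∃ m : ℤ, V.valuation y = V.valuation t ^ m) →
    IsDenseIn V (Subfield.closure ((k' : Set Ω) ∪ {t})) K'

/-- Statement of `stub_uniformizer_separating` (a separating transcendence basis led by an
element of the value of the uniformizer, in tower form). [cite: KnafKuhlmann2009, Prop. 2.3] -/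
def Sig.stub_uniformizer_separating : Prop :=
  ∀ {Ω : Type} [Field Ω] (V : ValuationSubring Ω) (k' K' : Subfield Ω) [PerfectField k'] (t : Ω),
    k' ≤ K' → FGOver k' K' → (k' : Set Ω) ⊆ V → t ∈ K' → V.valuation t < 1 →
    (∀ y ∈ K', y ≠ 0 → ∃ m : ℤ, V.valuation y = V.valuation t ^ m) →
    ∃ (t' : Ω) (n : ℕ) (x : Fin n → Ω), t' ∈ K' ∧ V.valuation t' = V.valuation t ∧
      (∀ i, x i ∈ K') ∧
      (∀ i : Fin n, ∀ P : Polynomial Ω,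
        (∀ m, P.coeff m ∈ Subfield.closure ((k' : Set Ω) ∪ insert t' (x '' {j | j < i}))) →
        P.eval (x i) = 0 → P = 0) ∧
      FiniteSeparableOver (Subfield.closure ((k' : Set Ω) ∪ insert t' (Set.range x))) K'

/-- Statement of `stub_denseTranscStep` (KK09 Lemma 2.16, completion case, + Lemma 3.9).
[cite: KnafKuhlmann2009, Lemma 2.16 and Lemma 3.9] -/
def Sig.stub_denseTranscStep : Prop :=
  ∀ {Ω : Type} [Field Ω] [IsAlgClosed Ω] (V : ValuationSubring Ω) (K : Subfield Ω) (z : Ω),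
    (∀ P : Polynomial Ω, (∀ m, P.coeff m ∈ K) → P.eval z = 0 → P = 0) →
    IsDenseIn V K (Subfield.closure ((K : Set Ω) ∪ {z})) →
    ∀ Z : Finset Ω, (∀ w ∈ Z, w ∈ V ∧ w ∈ Subfield.closure ((K : Set Ω) ∪ {z})) →
    IsSmoothlyUniformizableIn ↥(V.toSubring ⊓ K.toSubring) V
      (Subfield.closure ((K : Set Ω) ∪ {z})) (Z : Set Ω)

/-- Statement of `stub_denseAlgStep` (KK09 Prop. 3.11, last paragraph, + Lemma 3.7 (2)).
[cite: KnafKuhlmann2009, Prop. 3.11 and Lemma 3.7] -/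
def Sig.stub_denseAlgStep : Prop :=
  ∀ {Ω : Type} [Field Ω] [IsAlgClosed Ω] (V : ValuationSubring Ω) (L F : Subfield Ω),
    L ≤ F → FiniteSeparableOver L F → IsDenseIn V L F →
    ∀ Z : Finset Ω, (∀ w ∈ Z, w ∈ V ∧ w ∈ F) →
    IsSmoothlyUniformizableIn ↥(V.toSubring ⊓ L.toSubring) V F (Z : Set Ω)

/-- Statement of `stub_pullback` (strong smooth `k`-uniformizability in `Ω ⊇ K` pulls back to a
finitely generated regular model `A ⊇ R` in `K`). [cite: KnafKuhlmann2009, Section 3.1 (p. 14)] -/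
def Sig.stub_pullback : Prop :=
  ∀ (k K Ω : Type) [Field k] [Field K] [Algebra k K] [Field Ω] [Algebra K Ω] [Algebra k Ω]
    [IsScalarTower k K Ω] (O : ValuationSubring K) (V : ValuationSubring Ω),
    V.comap (algebraMap K Ω) = O → (∀ c : k, algebraMap k K c ∈ O) →
    ∀ R : Subalgebra k K, R.FG → R.toSubring ≤ O.toSubring →
    (∀ Z : Finset Ω, (∀ z ∈ Z, z ∈ V ∧ z ∈ (algebraMap K Ω).fieldRange) →
      IsSmoothlyUniformizableIn (algebraMap k Ω).fieldRange V (algebraMap K Ω).fieldRange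
        (Z : Set Ω)) →
    ∃ (A : Subalgebra k K) (h : A.toSubring ≤ O.toSubring), R ≤ A ∧ A.FG ∧
      IsFractionRing A K ∧ IsRegularLocalRing
        (Localization.AtPrime (Ideal.comap (Subring.inclusion h) (IsLocalRing.maximalIdeal O)))

/-- Statement of `stub_discreteAssembly` (the lead's stub: the five discrete stubs give the
discrete branch). [cite: KnafKuhlmann2009, Thm. 1.5 and Prop. 3.11] -/
def Sig.stub_discreteAssembly : Prop :=
  Sig.stub_discrete_isDenseIn → Sig.stub_uniformizer_separating → Sig.stub_denseTranscStep →
    Sig.stub_denseAlgStep → Sig.stub_pullback → Sig.lurelDiscrete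

/-- Statement of `stub_denseAbhyankarAssembly` (the c2 lead's stub: the five dense-Abhyankar stub
statements and the landed pull-back give the dense-Abhyankar branch).
[cite: KnafKuhlmann2009, Thm. 1.5] -/
def Sig.stub_denseAbhyankarAssembly : Prop :=
  Sig.stub_isAbhyankarPlace_map → Sig.stub_linDisjoint_of_dense_defectless →
    Sig.stub_separablyGenerated_of_linDisjoint → Sig.stub_separatingTower →
    Sig.stub_denseTower_ambient → Sig.stub_pullback → Sig.lurelDenseAbhyankar

/-- Statement `regular_of_shadowFrame` (the certifying half; PROVED in cycle 0 from the three
`Sig.stub_*` below, all landed). [cite: KnafKuhlmann2005, Section 2; Matsumura1987, Thm. 5.6] -/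
def Sig.stub_regular_of_shadowFrame : Prop :=
  ∀ (k K : Type) [Field k] [Field K] [Algebra k K] (O : ValuationSubring K) (A : Subalgebra k K)
    (h : A.toSubring ≤ O.toSubring), A.FG → ToricShadowFrame O A h →
    IsRegularLocalRing
      (Localization.AtPrime (Ideal.comap (Subring.inclusion h) (IsLocalRing.maximalIdeal O)))

/-- Statement of `stub_frameQuotientEquiv` (`(ker ψ)B` is prime and `B ⧸ (ker ψ)B ≃+* D`).
[folklore] -/
def Sig.stub_frameQuotientEquiv : Prop :=
  ∀ (k K L : Type) [Field k] [Field K] [Algebra k K] [Field L] [Algebra k L]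
    (O : ValuationSubring K) (A : Subalgebra k K) (h : A.toSubring ≤ O.toSubring)
    (ψ : A →ₐ[k] L) (O' : ValuationSubring L) (hψ : ψ.range.toSubring ≤ O'.toSubring),
    (∀ a : A, O'.valuation (ψ a) < 1 ↔ O.valuation (a : K) < 1) →
    (Ideal.map (algebraMap A.toSubring (Localization.AtPrime
        (Ideal.comap (Subring.inclusion h) (IsLocalRing.maximalIdeal O)))) (RingHom.ker ψ)).IsPrime ∧
    Nonempty ((Localization.AtPrime (Ideal.comap (Subring.inclusion h) (IsLocalRing.maximalIdeal O)) ⧸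
        Ideal.map (algebraMap A.toSubring (Localization.AtPrime
          (Ideal.comap (Subring.inclusion h) (IsLocalRing.maximalIdeal O)))) (RingHom.ker ψ)) ≃+*
      Localization.AtPrime (Ideal.comap (Subring.inclusion hψ) (IsLocalRing.maximalIdeal O')))

/-- Statement of `stub_shadowLocalRing_regular` (the shadow's local ring `D` is regular).
[cite: KnafKuhlmann2005, Thm. 2.1; Matsumura1987, Thm. 5.6] -/
def Sig.stub_shadowLocalRing_regular : Prop :=
  ∀ (k L : Type) [Field k] [Field L] [Algebra k L] (O' : ValuationSubring L) (C : Subalgebra k L)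
    (hC : C.toSubring ≤ O'.toSubring), C.FG →
    (∀ z : L, z ∈ O' → ∃ c : k, O'.valuation (z - algebraMap k L c) < 1) →
    ∀ (r : ℕ) (y : Fin r → L) (hy : ∀ i, y i ∈ C), IsValueIndependent O' y →
    IsLocalRing.maximalIdeal
        (Localization.AtPrime (Ideal.comap (Subring.inclusion hC) (IsLocalRing.maximalIdeal O'))) =
      Ideal.span (Set.range fun i => algebraMap C.toSubring
        (Localization.AtPrime (Ideal.comap (Subring.inclusion hC) (IsLocalRing.maximalIdeal O')))
        ⟨y i, hy i⟩) →
    IsRegularLocalRing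
      (Localization.AtPrime (Ideal.comap (Subring.inclusion hC) (IsLocalRing.maximalIdeal O')))

/-- Statement of `stub_regular_of_regularQuotient_ci` (regularity lifts along a
complete-intersection prime in the catenary local domain `A_P`).
[cite: Matsumura1987, §5 p. 31 and Thm. 14.2] -/
def Sig.stub_regular_of_regularQuotient_ci : Prop :=
  ∀ (k K : Type) [Field k] [Field K] [Algebra k K] (A : Subalgebra k K), A.FG →
    ∀ (P : Ideal A.toSubring) [P.IsPrime] (Q : Ideal (Localization.AtPrime P)) [Q.IsPrime],
    IsRegularLocalRing (Localization.AtPrime P ⧸ Q) →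
    ∀ S : Finset (Localization.AtPrime P), Ideal.span (S : Set (Localization.AtPrime P)) = Q →
    (S.card : ℕ∞) = Q.height → IsRegularLocalRing (Localization.AtPrime P)

/-! ## The stubs -/

/-- **STUB (load-bearing, open-problem sized): the toric transfer on the core locus.**
Shadows exact on every finite `F` ⇒ an affine model with a toric shadow frame at the centre,
for `O` of NON-cyclic value group which is NOT an Abhyankar place (module docstring: overweight
presentation of the shadow, regular fan uniformizing `ν'`, the same monomial chart applied to
`R₁`, transversality, tight algebraisation). On the typed hypothesis this is conceded to contain
relative local uniformization at the non-Abhyankar, non-discrete rational places (the route's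
target `LurelRational` on that class; worker verdict `stub-blocked: LurelRational`, c1 wave 1).
[cite: arXiv:2311.12456, p. 5; arXiv:1401.5204, Thm. 3.12, Thm. 4.3, Cor. 6.25;
arXiv:2607.11223, Thm. 1.1] -/
theorem stub_shadowFrameTransfer_core (p : ℕ) (hp : p.Prime) (k K : Type) [Field k]
    [CharP k p] [IsAlgClosed k] [Field K] [Algebra k K] (hfg : (⊤ : IntermediateField k K).FG)
    (O : ValuationSubring K) (hk : ∀ c : k, algebraMap k K c ∈ O)
    (hrat : ∀ x : K, x ∈ O → ∃ c : k, O.valuation (x - algebraMap k K c) < 1)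
    (hndisc : ¬ IsCyclic (O.ValueGroup)ˣ) (hnA : ¬ IsAbhyankarPlace O (algebraMap k K).fieldRange ⊤)
    (hnD : ¬ IsDenseAbhyankar (k := k) O) (hnU : ¬ IsCompositeUniformizable (k := k) O)
    (hnG : ¬ HasRegularCentreDimLeTwo (k := k) O)
    (R : Subalgebra k K) (hR : R.FG) (hRO : R.toSubring ≤ O.toSubring) (hsh : HasShadows O R) :
    ∃ (A : Subalgebra k K) (h : A.toSubring ≤ O.toSubring), R ≤ A ∧ A.FG ∧
      IsFractionRing A K ∧ ToricShadowFrame O A h := by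
  sorry

/-! ### The regular-centre branch (lead c3, reshape #5): Abhyankar's union lemma -/

/-- **LANDED (p169355, `Theorems/AbhyankarShadowsShadowsUniformizeRegularCentreTransfer.lean`; c3 wave 2; the transfer): one regular centre of dimension `≤ 2` uniformizes every `R`.**
For fields `k ⊆ K`, a valuation ring `O` of `K`, and a finitely generated `B ⊆ O` with
`Frac B = K` whose local ring at the centre is regular of dimension `≤ 2`: every finitely
generated `R ⊆ O` lies in a finitely generated `A ⊆ O`, `Frac A = K`, regular at the centre.
Dimension `≤ 1`: `O = B_𝔭` (`stub_eqOfDominatesOfDimLeOne`), take `A = B[gens R]`. Dimension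
`2`: `O ≠ K`; the quadratic sequence `B_𝔭 = R₀ → R₁ → ⋯` along `O` exists
(`stub_quadraticSequence`), `O = ⋃ Rᵢ` (`AbhyankarQuadraticUnion_holds`), so the generators of
`R` lie in some `R_N = (B[t])_{𝔪_O ∩ B[t]}` (`stub_sequenceCollapse`), regular
(`isRegularLocalRing_sequence`); `A := B[t][gens R]` has `locAtCentre A O = R_N`
(`B[t] ≤ A ≤ R_N = locAtCentre B[t] O`, `locAtCentre_mono`, `locAtCentre_locAtCentre`); read
regularity back through `isRegularLocalRing_locAtCentre_iff`. [cite: Abhyankar1956Valuations, Lemma 12] -/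
theorem stub_lurel_of_regularCentre (k K : Type) [Field k] [Field K] [Algebra k K]
    (O : ValuationSubring K) (B : Subalgebra k K) (hBfg : B.FG) (hBO : B.toSubring ≤ O.toSubring)
    (hfrac : IsFractionRing B K)
    (hreg : IsRegularLocalRing
      (Localization.AtPrime (Ideal.comap (Subring.inclusion hBO) (IsLocalRing.maximalIdeal O))))
    (hdim : ringKrullDim
      (Localization.AtPrime (Ideal.comap (Subring.inclusion hBO) (IsLocalRing.maximalIdeal O))) ≤ 2)
    (R : Subalgebra k K) (hR : R.FG) (hRO : R.toSubring ≤ O.toSubring) :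
    ∃ (A : Subalgebra k K) (h : A.toSubring ≤ O.toSubring), R ≤ A ∧ A.FG ∧
      IsFractionRing A K ∧ IsRegularLocalRing
        (Localization.AtPrime (Ideal.comap (Subring.inclusion h) (IsLocalRing.maximalIdeal O))) :=
  Summit.ResolutionOfSingularities.ResolutionOfSingularities.Theorems.stub_lurel_of_regularCentre
    k K O B hBfg hBO hfrac hreg hdim R hR hRO

/-- **LANDED (p169314, `Theorems/AbhyankarShadowsShadowsUniformizePlaneRegularCentre.lean`; c3 wave 2; the plane): every valuation ring of `k(x, y)` has a regular centre of
dimension `≤ 2` on an affine model** — `B = k[x', y']`, `x' ∈ {x, x⁻¹} ∩ O`,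
`y' ∈ {y, y⁻¹} ∩ O`, a polynomial ring in two algebraically independent generators of `K`.
[folklore] -/
theorem stub_regularCentre_of_purelyTranscendental (k K : Type) [Field k] [Field K] [Algebra k K]
    (x y : K) (hxy : AlgebraicIndependent k ![x, y]) (hgen : IntermediateField.adjoin k {x, y} = ⊤)
    (O : ValuationSubring K) (hk : ∀ c : k, algebraMap k K c ∈ O) :
    ∃ (B : Subalgebra k K) (h : B.toSubring ≤ O.toSubring), B.FG ∧ IsFractionRing B K ∧
      IsRegularLocalRing
        (Localization.AtPrime (Ideal.comap (Subring.inclusion h) (IsLocalRing.maximalIdeal O))) ∧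
      ringKrullDim
        (Localization.AtPrime (Ideal.comap (Subring.inclusion h) (IsLocalRing.maximalIdeal O))) ≤ 2 :=
  Summit.ResolutionOfSingularities.ResolutionOfSingularities.Theorems.stub_regularCentre_of_purelyTranscendental
    k K x y hxy hgen O hk

/-- **LANDED (p170270, `Theorems/AbhyankarShadowsShadowsUniformizeRuledRegularCentre.lean`; c3 wave 3; ruled surfaces): every valuation ring of `F(x)`, `trdeg_k F ≤ 1`, has a
regular centre of dimension `≤ 2` on an affine model** — `A₁[x']` with `A₁ ⊆ O ∩ F` a model of
the curve `F` regular at the centre (finite normalization) and `x' ∈ {x, x⁻¹} ∩ O`. [folklore] -/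
theorem stub_regularCentre_of_ruled (k K : Type) [Field k] [Field K] [Algebra k K]
    (F : IntermediateField k K) (hF : F.FG) (hF1 : Algebra.trdeg k F ≤ 1) (x : K)
    (hx : Transcendental F x) (hgen : IntermediateField.adjoin F {x} = ⊤)
    (O : ValuationSubring K) (hk : ∀ c : k, algebraMap k K c ∈ O) :
    ∃ (B : Subalgebra k K) (h : B.toSubring ≤ O.toSubring), B.FG ∧ IsFractionRing B K ∧
      IsRegularLocalRing
        (Localization.AtPrime (Ideal.comap (Subring.inclusion h) (IsLocalRing.maximalIdeal O))) ∧
      ringKrullDim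
        (Localization.AtPrime (Ideal.comap (Subring.inclusion h) (IsLocalRing.maximalIdeal O))) ≤ 2 :=
  Summit.ResolutionOfSingularities.ResolutionOfSingularities.Theorems.stub_regularCentre_of_ruled
    k K F hF hF1 x hx hgen O hk

/-- **PROVED (lead c3; typed and LANDED as `lurel_ruled`, `Theorems/AbhyankarShadowsShadowsUniformizeLurelRegularCentre.lean`): relative local uniformization for ruled surfaces `F(x)`** from the
transfer and the ruled stub. [folklore] -/
theorem lurelRuled_of (hT : Sig.stub_lurel_of_regularCentre) (hRu : Sig.stub_regularCentre_of_ruled) :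
    Sig.lurelRuled := by
  intro k K _ _ _ F hF hF1 x hx hgen O hk R hR hRO
  obtain ⟨B, hBO, hBfg, hfrac, hreg, hdim⟩ := hRu k K F hF hF1 x hx hgen O hk
  exact hT k K O B hBfg hBO hfrac hreg hdim R hR hRO

/-- **Relative local uniformization for ruled surfaces** (from the registered stubs). [folklore] -/
theorem lurelRuled : Sig.lurelRuled :=
  lurelRuled_of stub_lurel_of_regularCentre stub_regularCentre_of_ruled

/-- **PROVED (lead c3; typed and LANDED as `lurel_of_hasRegularCentreDimLeTwo` / `lurel_purelyTranscendental_two`, `Theorems/AbhyankarShadowsShadowsUniformizeLurelRegularCentre.lean`): the regular-centre branch and the `k(x, y)` theorem from the two c3 #5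
stub statements** (unfold the locus and apply the transfer; for the plane, the second stub
supplies the regular centre). [cite: Abhyankar1956Valuations, Lemma 12] -/
theorem stub_regularCentreAssembly : Sig.stub_regularCentreAssembly := by
  intro hT hP
  refine ⟨fun k K _ _ _ O hG R hR hRO => ?_, fun k K _ _ _ x y hxy hgen O hk R hR hRO => ?_⟩
  · obtain ⟨B, hBO, hBfg, hfrac, hreg, hdim⟩ := hG
    exact hT k K O B hBfg hBO hfrac hreg hdim R hR hRO
  · obtain ⟨B, hBO, hBfg, hfrac, hreg, hdim⟩ := hP k K x y hxy hgen O hk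
    exact hT k K O B hBfg hBO hfrac hreg hdim R hR hRO

/-- **The regular-centre branch** (from the registered c3 #5 stubs). [cite: Abhyankar1956Valuations, Lemma 12] -/
theorem lurelRegularCentre : Sig.lurelRegularCentre :=
  (stub_regularCentreAssembly stub_lurel_of_regularCentre stub_regularCentre_of_purelyTranscendental).1

/-- **Relative local uniformization of `k(x, y)` along every valuation** (from the registered
c3 #5 stubs). [cite: Abhyankar1956Valuations, Lemma 12] -/
theorem lurelPurelyTranscendentalTwo : Sig.lurelPurelyTranscendentalTwo :=
  (stub_regularCentreAssembly stub_lurel_of_regularCentre stub_regularCentre_of_purelyTranscendental).2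

/-! ### The composite-uniformizable branch (lead c3, reshape #4): residue valuation in any proved locus -/

/-- **LANDED (p167465, `Theorems/AbhyankarShadowsShadowsUniformizeAbhyankarResidueTransport.lean`; c3 wave 1): transport of the Abhyankar property between abstract residue fields.**
For surjective field homomorphisms `ι : κ → L`, `ι' : κ' → L` compatible with the `k`-algebra
structures, `e := ι'⁻¹ ∘ ι : κ ≃ κ'` satisfies `(W ∘ ι')⁻¹-compatibility` `(W.comap ι').comap e =
W.comap ι`, maps `(algebraMap k κ).fieldRange` onto `(algebraMap k κ').fieldRange` and `⊤` onto
`⊤`; conclude by `isAbhyankarPlace_map e`. [folklore] -/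
theorem stub_isAbhyankarPlace_residue_transport (k κ κ' L : Type) [Field k] [Field κ] [Field κ']
    [Field L] [Algebra k κ] [Algebra k κ'] (W : ValuationSubring L) (ι : κ →+* L) (ι' : κ' →+* L)
    (hι : Function.Surjective ι) (hι' : Function.Surjective ι')
    (hcompat : ∀ c : k, ι (algebraMap k κ c) = ι' (algebraMap k κ' c))
    (hA : IsAbhyankarPlace (W.comap ι) (algebraMap k κ).fieldRange ⊤) :
    IsAbhyankarPlace (W.comap ι') (algebraMap k κ').fieldRange ⊤ :=
  Summit.ResolutionOfSingularities.ResolutionOfSingularities.Theorems.stub_isAbhyankarPlace_residue_transport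
    k κ κ' L W ι ι' hι hι' hcompat hA

/-- **LANDED (p167624, `Theorems/AbhyankarShadowsShadowsUniformizeDenseResidueTransport.lean`; c3 wave 1): transport of the dense-Abhyankar property between abstract residue
fields.** With `e := ι'⁻¹ ∘ ι : κ ≃ₐ[k] κ'` as above: `κ₀' := κ₀.map e` is finitely generated,
the place stays Abhyankar on it (`isAbhyankarPlace_map`) and density is transported
(`isDenseIn_map`, `⊤.map e = ⊤`). [folklore] -/
theorem stub_isDenseAbhyankar_residue_transport (k κ κ' L : Type) [Field k] [Field κ] [Field κ']
    [Field L] [Algebra k κ] [Algebra k κ'] (W : ValuationSubring L) (ι : κ →+* L) (ι' : κ' →+* L)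
    (hι : Function.Surjective ι) (hι' : Function.Surjective ι')
    (hcompat : ∀ c : k, ι (algebraMap k κ c) = ι' (algebraMap k κ' c))
    (hD : ∃ κ₀ : IntermediateField k κ, κ₀.FG ∧
      IsAbhyankarPlace (W.comap ι) (algebraMap k κ).fieldRange κ₀.toSubfield ∧
      IsDenseIn (W.comap ι) κ₀.toSubfield ⊤) :
    ∃ κ₀' : IntermediateField k κ', κ₀'.FG ∧
      IsAbhyankarPlace (W.comap ι') (algebraMap k κ').fieldRange κ₀'.toSubfield ∧
      IsDenseIn (W.comap ι') κ₀'.toSubfield ⊤ :=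
  Summit.ResolutionOfSingularities.ResolutionOfSingularities.Theorems.stub_isDenseAbhyankar_residue_transport
    k κ κ' L W ι ι' hι hι' hcompat hD

/-- **LANDED (p167495, `Theorems/AbhyankarShadowsShadowsUniformizeCompositeResidueAbhyankar.lean`; c3 wave 1; the residue side, Abhyankar case).** For `k ⊆ O ≤ O₁` in `K` (`k` algebraically
closed), `κ(O₁)` generated over `k` by residues of finitely many elements of `O`, and the residue
valuation ring `O₂ = O / m_{O₁}` read through a `k`-compatible surjective `ι : κ → κ(O₁)`: if
`ι⁻¹(O₂)` is an Abhyankar place of `κ/k` then it admits relative local uniformization over `k` —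
`κ/k` is finitely generated (`fg_top_of_surjective`), `k ⊆ ι⁻¹(O₂)`
(`algebraMap_mem_comap_residueValuationSubring`), and Knaf–Kuhlmann 2005 Thm. 1.1 applies on `κ`
(`relLU_at_abhyankarPlace_of_perfectField`; no rationality needed).
[cite: KnafKuhlmann2005, Thm. 1.1 and Cor. 2.2] -/
theorem stub_composite_residue_abhyankar (k K : Type) [Field k] [IsAlgClosed k] [Field K]
    [Algebra k K] (O O₁ : ValuationSubring K) (hO : O ≤ O₁) (hk : ∀ c : k, algebraMap k K c ∈ O)
    (hgen : ∃ S : Finset O, ∀ T : Subfield (IsLocalRing.ResidueField O₁),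
      (∀ c : k, IsLocalRing.residue O₁ ⟨algebraMap k K c, hO (hk c)⟩ ∈ T) →
      (∀ s ∈ S, IsLocalRing.residue O₁ ⟨(s : K), hO s.2⟩ ∈ T) → T = ⊤)
    (κ : Type) [Field κ] [Algebra k κ] (ι : κ →+* IsLocalRing.ResidueField O₁)
    (hι : Function.Surjective ι)
    (hιk : ∀ c : k, ι (algebraMap k κ c) = IsLocalRing.residue O₁ ⟨algebraMap k K c, hO (hk c)⟩)
    (hA : IsAbhyankarPlace ((residueValuationSubring O O₁ hO).comap ι)
      (algebraMap k κ).fieldRange ⊤)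
    (R : Subalgebra k κ) (hR : R.FG)
    (hRO : R.toSubring ≤ ((residueValuationSubring O O₁ hO).comap ι).toSubring) :
    ∃ (B : Subalgebra k κ) (hB : B.toSubring ≤ ((residueValuationSubring O O₁ hO).comap ι).toSubring),
      R ≤ B ∧ B.FG ∧ IsRegularLocalRing (Localization.AtPrime (Ideal.comap (Subring.inclusion hB)
        (IsLocalRing.maximalIdeal ((residueValuationSubring O O₁ hO).comap ι)))) :=
  Summit.ResolutionOfSingularities.ResolutionOfSingularities.Theorems.stub_composite_residue_abhyankar
    k K O O₁ hO hk hgen κ ι hι hιk hA R hR hRO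

/-- **LANDED (p167514, `Theorems/AbhyankarShadowsShadowsUniformizeCompositeResidueDense.lean`; c3 wave 1; the residue side, dense-Abhyankar case).** As above, with `char k = p`: if
`ι⁻¹(O / m_{O₁})` lies in the dense-Abhyankar locus of `κ/k` (unfolded) then it admits relative
local uniformization over `k` — `κ/k` finitely generated, `k ⊆ ι⁻¹(O₂)`, `char κ = p`
(`charP_of_injective_algebraMap`), and the c2 theorem `lurelRational_of_isDenseAbhyankar` on `κ`.
[cite: KnafKuhlmann2009, Thm. 1.5] -/
theorem stub_composite_residue_dense (p : ℕ) (hp : p.Prime) (k K : Type) [Field k] [CharP k p]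
    [IsAlgClosed k] [Field K] [Algebra k K] (O O₁ : ValuationSubring K) (hO : O ≤ O₁)
    (hk : ∀ c : k, algebraMap k K c ∈ O)
    (hgen : ∃ S : Finset O, ∀ T : Subfield (IsLocalRing.ResidueField O₁),
      (∀ c : k, IsLocalRing.residue O₁ ⟨algebraMap k K c, hO (hk c)⟩ ∈ T) →
      (∀ s ∈ S, IsLocalRing.residue O₁ ⟨(s : K), hO s.2⟩ ∈ T) → T = ⊤)
    (κ : Type) [Field κ] [Algebra k κ] (ι : κ →+* IsLocalRing.ResidueField O₁)
    (hι : Function.Surjective ι)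
    (hιk : ∀ c : k, ι (algebraMap k κ c) = IsLocalRing.residue O₁ ⟨algebraMap k K c, hO (hk c)⟩)
    (hD : ∃ κ₀ : IntermediateField k κ, κ₀.FG ∧
      IsAbhyankarPlace ((residueValuationSubring O O₁ hO).comap ι)
        (algebraMap k κ).fieldRange κ₀.toSubfield ∧
      IsDenseIn ((residueValuationSubring O O₁ hO).comap ι) κ₀.toSubfield ⊤)
    (R : Subalgebra k κ) (hR : R.FG)
    (hRO : R.toSubring ≤ ((residueValuationSubring O O₁ hO).comap ι).toSubring) :
    ∃ (B : Subalgebra k κ) (hB : B.toSubring ≤ ((residueValuationSubring O O₁ hO).comap ι).toSubring),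
      R ≤ B ∧ B.FG ∧ IsRegularLocalRing (Localization.AtPrime (Ideal.comap (Subring.inclusion hB)
        (IsLocalRing.maximalIdeal ((residueValuationSubring O O₁ hO).comap ι)))) :=
  Summit.ResolutionOfSingularities.ResolutionOfSingularities.Theorems.stub_composite_residue_dense
    p hp k K O O₁ hO hk hgen κ ι hι hιk hD R hR hRO

/-! ### The dense-Abhyankar branch (lead c2): Knaf–Kuhlmann 2009, Thm. 1.5 in general -/

/-- **LANDED (p160670, `Theorems/AbhyankarShadowsShadowsUniformizeIsAbhyankarPlaceMap.lean`; the tree already had `isAbhyankarPlace_map`): transport of the Abhyankar property along a field embedding.** If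
`ι : Ω → Ω'` is a field homomorphism with `ι⁻¹(V') = V`, an Abhyankar place `(F|K, V)` maps to an
Abhyankar place `(ι F | ι K, V')`: the value-independent `xᵢ` and the residually independent `yⱼ`
are moved by `ι` (values along `valuation_map_eq_iff`, residues along the induced embedding of
residue fields, algebraicity along `isAlgebraic_adjoin_map_iff`). [folklore] -/
theorem stub_isAbhyankarPlace_map {Ω Ω' : Type} [Field Ω] [Field Ω'] (ι : Ω →+* Ω')
    {V : ValuationSubring Ω} {V' : ValuationSubring Ω'} (hV : V'.comap ι = V) {K F : Subfield Ω}
    (h : IsAbhyankarPlace V K F) : IsAbhyankarPlace V' (K.map ι) (F.map ι) :=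
  Summit.ResolutionOfSingularities.ResolutionOfSingularities.Theorems.stub_isAbhyankarPlace_map ι hV h

/-- **LANDED (p162032, `Theorems/AbhyankarShadowsShadowsUniformizeLinDisjoint.lean`; Knaf–Kuhlmann 2009, Lemma 3.12 — the heart): a dense extension of a defectless field is
linearly disjoint from purely inseparable extensions of exponent one.** For subfields `F₀ ≤ K'` of
an algebraically closed valued field `(Ω, V)` of characteristic `p` with `F₀` dense in `K'` and
`(F₀, V ∩ F₀)` a defectless field: if `d₁, …, dₙ ∈ Ω` have `dᵢᵖ ∈ F₀`, `s₁, …, sₙ ∈ K'` are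
`F₀`-linearly independent and `∑ dᵢ sᵢ = 0`, then all `dᵢ = 0`. (Proof: `L = F₀(d)` is purely
inseparable, so `V ∩ L` is the only extension of `V ∩ F₀` and defectlessness reads
`[L : F₀] = e·f`; representatives `aᵢ ∈ L` of `vL/vF₀` and `bⱼ ∈ V ∩ L` of a basis of `Lv/F₀v`
give `e·f` products `aᵢbⱼ`, an `F₀`-basis of `L`, which stay `K'`-linearly independent by the
fundamental inequality `linearIndependent_mul_of_valuation_of_residue` because `vK' = vF₀` and
`K'v = F₀v` (density); expand the `dᵢ` in this basis.) [cite: KnafKuhlmann2009, Lemma 3.12] -/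
theorem stub_linDisjoint_of_dense_defectless {Ω : Type} [Field Ω] [IsAlgClosed Ω]
    (V : ValuationSubring Ω) (p : ℕ) [Fact p.Prime] [CharP Ω p] (F₀ K' : Subfield Ω)
    (hle : F₀ ≤ K') (hdense : IsDenseIn V F₀ K')
    (hdef : IsDefectlessField F₀ (V.comap (algebraMap F₀ Ω)))
    (n : ℕ) (d s : Fin n → Ω) (hd : ∀ i, d i ^ p ∈ F₀) (hs : ∀ i, s i ∈ K')
    (hsi : LinearIndependent F₀ s) (hsum : ∑ i, d i * s i = 0) : ∀ i, d i = 0 :=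
  Summit.ResolutionOfSingularities.ResolutionOfSingularities.Theorems.stub_linDisjoint_of_dense_defectless
    V p F₀ K' hle hdense hdef n d s hd hs hsi hsum

/-- **LANDED (p161026, `Theorems/AbhyankarShadowsShadowsUniformizeSeparablyGenerated.lean`; Mac Lane's criterion, ambient form).** For subfields `F₀ ≤ K'` of an algebraically
closed field `Ω` of characteristic `p` with `K' | F₀` finitely generated: if `F₀`-linearly
independent elements of `K'` are never annihilated by coefficients `dᵢ` with `dᵢᵖ ∈ F₀` (linear
disjointness from `F₀^{1/p}`), then `K' | F₀` is separably generated (Mathlib's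
`exists_isTranscendenceBasis_and_isSeparable_of_linearIndepOn_pow_of_essFiniteType` applied to the
intermediate field `Subfield.extendScalars hle`, read back in `Ω`). [folklore] -/
theorem stub_separablyGenerated_of_linDisjoint {Ω : Type} [Field Ω] [IsAlgClosed Ω] (p : ℕ)
    [Fact p.Prime] [CharP Ω p] (F₀ K' : Subfield Ω) (hle : F₀ ≤ K') (hfg : FGOver F₀ K')
    (hld : ∀ (n : ℕ) (d s : Fin n → Ω), (∀ i, d i ^ p ∈ F₀) → (∀ i, s i ∈ K') →
      LinearIndependent F₀ s → ∑ i, d i * s i = 0 → ∀ i, d i = 0) :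
    SeparablyGeneratedOver F₀ K' :=
  Summit.ResolutionOfSingularities.ResolutionOfSingularities.Theorems.stub_separablyGenerated_of_linDisjoint
    p F₀ K' hle hfg hld

/-- **LANDED (p160702, `Theorems/AbhyankarShadowsShadowsUniformizeSeparatingTower.lean`): a separating transcendence basis in tower form.** If `K' | F₀` is finitely generated and
separably generated, there are `x₁, …, xₙ ∈ K'` with each `xᵢ` transcendental over `F₀(x_{<i})`
(rendered polynomially) and `K' | F₀(x)` finite separable (enumerate a separating transcendence
basis; `eq_zero_of_algebraicIndependent_of_notMem`, `finiteSeparableOver_closure_of_isSeparable`).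
[folklore] -/
theorem stub_separatingTower {Ω : Type} [Field Ω] (F₀ K' : Subfield Ω) (hle : F₀ ≤ K')
    (hfg : FGOver F₀ K') (hsep : SeparablyGeneratedOver F₀ K') :
    ∃ (n : ℕ) (x : Fin n → Ω), (∀ i, x i ∈ K') ∧
      (∀ i : Fin n, ∀ P : Polynomial Ω,
        (∀ m, P.coeff m ∈ Subfield.closure ((F₀ : Set Ω) ∪ x '' {j | j < i})) →
        P.eval (x i) = 0 → P = 0) ∧
      FiniteSeparableOver (Subfield.closure ((F₀ : Set Ω) ∪ Set.range x)) K' :=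
  Summit.ResolutionOfSingularities.ResolutionOfSingularities.Theorems.stub_separatingTower F₀ K' hle hfg hsep

/-- **LANDED (p160776, `Theorems/AbhyankarShadowsShadowsUniformizeDenseTower.lean`; Knaf–Kuhlmann 2009, Prop. 3.11 over an Abhyankar base).** For `k' ≤ F₀ ≤ K'` subfields
of an algebraically closed valued field `(Ω, V)` with `k'` perfect and `⊆ O_V`, `F₀ | k'` finitely
generated and an Abhyankar place, `K'` dense over `F₀`, and a separating tower `x` of `K' | F₀`:
every finite `Z ⊆ O_V ∩ K'` is smoothly `O_{k'}`-uniformizable — base `F₀` by KK05 Thm. 1.1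
(`KnafKuhlmann2005_Thm11_holds` with Cor. 2.2 and `separablyGeneratedOver_of_perfectField`, cf.
`relLU_at_abhyankarPlace_of_perfectField`; `isSmoothlyUniformizableIn_inf_iff`), dense
transcendental steps `stub_denseTranscStep`, the dense finite separable top `stub_denseAlgStep`,
stacked by Cor. 3.6 `knafKuhlmann2009_cor36` (the induction of `ambient_discrete` with a general
base). [cite: KnafKuhlmann2009, Prop. 3.11 and Thm. 1.5] -/
theorem stub_denseTower_ambient {Ω : Type} [Field Ω] [IsAlgClosed Ω] (V : ValuationSubring Ω)
    (k' F₀ K' : Subfield Ω) [PerfectField k'] (hk : k' ≤ F₀) (hF₀K : F₀ ≤ K')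
    (hfg₀ : FGOver k' F₀) (hkV : (k' : Set Ω) ⊆ V) (hA : IsAbhyankarPlace V k' F₀)
    (hdense : IsDenseIn V F₀ K') (n : ℕ) (x : Fin n → Ω) (hxK : ∀ i, x i ∈ K')
    (htransc : ∀ i : Fin n, ∀ P : Polynomial Ω,
      (∀ m, P.coeff m ∈ Subfield.closure ((F₀ : Set Ω) ∪ x '' {j | j < i})) →
      P.eval (x i) = 0 → P = 0)
    (hfinsep : FiniteSeparableOver (Subfield.closure ((F₀ : Set Ω) ∪ Set.range x)) K')
    (Z : Finset Ω) (hZ : ∀ z ∈ Z, z ∈ V ∧ z ∈ K') :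
    IsSmoothlyUniformizableIn ↥(V.toSubring ⊓ k'.toSubring) V K' (Z : Set Ω) :=
  Summit.ResolutionOfSingularities.ResolutionOfSingularities.Theorems.stub_denseTower_ambient V k' F₀ K' hk hF₀K
    hfg₀ hkV hA hdense n x hxK htransc hfinsep Z hZ

/-- **LANDED (p162456): density is transported along a field embedding** compatible with the
valuation rings. [folklore] -/
theorem isDenseIn_map {Ω Ω' : Type} [Field Ω] [Field Ω'] (ι : Ω →+* Ω')
    {V : ValuationSubring Ω} {V' : ValuationSubring Ω'} (hV : V'.comap ι = V) {A B : Subfield Ω}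
    (h : IsDenseIn V A B) : IsDenseIn V' (A.map ι) (B.map ι) :=
  Summit.ResolutionOfSingularities.ResolutionOfSingularities.Theorems.isDenseIn_map ι hV h

/-- **LANDED (p162456, `Theorems/AbhyankarShadowsShadowsUniformizeLurelDenseAbhyankar.lean`; lead c2): the dense-Abhyankar branch, typed.** Embed `K ↪ Ω = K̄`, extend `O` to `V` (Chevalley), move
`k`, `K₀`, `K` to subfields `k' ≤ F₀ ≤ K'` of `Ω` (finite generation `fgOver_map`, the Abhyankar
property `stub_isAbhyankarPlace_map`, density `isDenseIn_map`); `(F₀, V ∩ F₀)` is a defectless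
field by the Generalized Stability Theorem (`Kuhlmann2010Stability_holds` with
`transcendenceDefect_comap_eq_zero_of_isAbhyankarPlace`); Lemma 3.12
(`stub_linDisjoint_of_dense_defectless`) and Mac Lane (`stub_separablyGenerated_of_linDisjoint`)
make `K' | F₀` separably generated, `stub_separatingTower` gives the tower, `stub_denseTower_ambient`
the ambient uniformizability, `stub_pullback` the typed regular model. [cite: KnafKuhlmann2009, Thm. 1.5] -/
theorem stub_denseAbhyankarAssembly : Sig.stub_denseAbhyankarAssembly := by
  -- The composition is LANDED as `Theorems/AbhyankarShadowsShadowsUniformizeLurelDenseAbhyankar.lean`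
  -- (p162456: `knafKuhlmann2009_thm15_denseAbhyankar` ambient + `lurelRational_of_isDenseAbhyankar`
  -- typed), which invokes the five landed stubs BY NAME; here the stub statements are therefore
  -- not consumed a second time.
  intro _ _ _ _ _ _ p hp k K _ _ _ _ _ hfg O hk hD R hR hRO
  exact Summit.ResolutionOfSingularities.ResolutionOfSingularities.Theorems.lurelRational_of_isDenseAbhyankar p hp k K hfg O hk hD
    R hR hRO

/-- **LANDED (p156322, `Theorems/AbhyankarShadowsShadowsUniformizeDiscreteIsDenseIn.lean`): density of the uniformizer's rational function field.** For subfields `k' ≤ K'` of a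
valued field `(Ω, V)` with `k' ⊆ O_V`, `t ∈ K'` of value `< 1`, every element of `O_V ∩ K'`
congruent to a constant of `k'` (rationality) and every non-zero value of `K'` a power of `v t`
(discreteness), `k'(t)` is dense in `K'`: `t`-adic expansion `y = c₀ + c₁ t + ⋯ + c_{N-1} t^{N-1}
+ t^N y_N`. [cite: KnafKuhlmann2009, Thm. 1.5] -/
theorem stub_discrete_isDenseIn {Ω : Type} [Field Ω] (V : ValuationSubring Ω)
    (k' K' : Subfield Ω) (t : Ω) (hkK : k' ≤ K') (hkV : (k' : Set Ω) ⊆ V) (ht : t ∈ K')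
    (ht1 : V.valuation t < 1) (hrat : ∀ y ∈ K', y ∈ V → ∃ c ∈ k', V.valuation (y - c) < 1)
    (hdisc : ∀ y ∈ K', y ≠ 0 → ∃ m : ℤ, V.valuation y = V.valuation t ^ m) :
    IsDenseIn V (Subfield.closure ((k' : Set Ω) ∪ {t})) K' :=
  Summit.ResolutionOfSingularities.ResolutionOfSingularities.Theorems.stub_discrete_isDenseIn
    V k' K' t hkK hkV ht ht1 hrat hdisc

/-- **LANDED (p156745, `Theorems/AbhyankarShadowsShadowsUniformizeUniformizerSeparating.lean`): a separating transcendence basis led by a uniformizer, as a tower.** For `k'`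
perfect, `K' | k'` finitely generated, `t ∈ K'` with `v t < 1` and every non-zero value of `K'`
a power of `v t`: there are `t' ∈ K'` with `v t' = v t` and `x₁, …, xₙ ∈ K'` with each `xᵢ`
transcendental over `k'(t', x_{<i})` and `K' | k'(t', x)` finite separable. (Differential
criterion: `K'|k'` has a separating transcendence basis `b`; if `dt ≠ 0` exchange `t` into it,
else `t' := t + t^p w` with `dw ≠ 0`, `v(t^p w) < v t`.) [cite: KnafKuhlmann2009, Prop. 2.3] -/
theorem stub_uniformizer_separating {Ω : Type} [Field Ω] (V : ValuationSubring Ω)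
    (k' K' : Subfield Ω) [PerfectField k'] (t : Ω) (hkK : k' ≤ K') (hfg : FGOver k' K')
    (hkV : (k' : Set Ω) ⊆ V) (ht : t ∈ K') (ht1 : V.valuation t < 1)
    (hdisc : ∀ y ∈ K', y ≠ 0 → ∃ m : ℤ, V.valuation y = V.valuation t ^ m) :
    ∃ (t' : Ω) (n : ℕ) (x : Fin n → Ω), t' ∈ K' ∧ V.valuation t' = V.valuation t ∧
      (∀ i, x i ∈ K') ∧
      (∀ i : Fin n, ∀ P : Polynomial Ω,
        (∀ m, P.coeff m ∈ Subfield.closure ((k' : Set Ω) ∪ insert t' (x '' {j | j < i}))) →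
        P.eval (x i) = 0 → P = 0) ∧
      FiniteSeparableOver (Subfield.closure ((k' : Set Ω) ∪ insert t' (Set.range x))) K' :=
  Summit.ResolutionOfSingularities.ResolutionOfSingularities.Theorems.stub_uniformizer_separating
    V k' K' t hkK hfg hkV ht ht1 hdisc

/-- **LANDED (p156494, `Theorems/AbhyankarShadowsShadowsUniformizeDenseTranscStep.lean`): the dense transcendental step** (KK09 Lemma 2.16 in the completion case — condition
(3) holds for `z` in the closure of `K`: `v g(a) = v g(z)` for `a` close to `z`, by Taylor
expansion — followed by Lemma 3.9 `isSmoothlyUniformizableIn_of_immediate_of_kaplansky`; density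
gives immediacy `IsDenseIn.isImmediateOver`). [cite: KnafKuhlmann2009, Lemma 2.16 and Lemma 3.9] -/
theorem stub_denseTranscStep {Ω : Type} [Field Ω] [IsAlgClosed Ω] (V : ValuationSubring Ω)
    (K : Subfield Ω) (z : Ω)
    (htrans : ∀ P : Polynomial Ω, (∀ m, P.coeff m ∈ K) → P.eval z = 0 → P = 0)
    (hdense : IsDenseIn V K (Subfield.closure ((K : Set Ω) ∪ {z})))
    (Z : Finset Ω) (hZ : ∀ w ∈ Z, w ∈ V ∧ w ∈ Subfield.closure ((K : Set Ω) ∪ {z})) :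
    IsSmoothlyUniformizableIn ↥(V.toSubring ⊓ K.toSubring) V
      (Subfield.closure ((K : Set Ω) ∪ {z})) (Z : Set Ω) :=
  Summit.ResolutionOfSingularities.ResolutionOfSingularities.Theorems.stub_denseTranscStep
    V K z htrans hdense Z hZ

/-- **LANDED (p156236, `Theorems/AbhyankarShadowsShadowsUniformizeDenseAlgStep.lean`): the dense finite separable step** (KK09 §3.4: a finite separable `F | L` inside the
completion lies in the henselization — Krasner over `L^h`,
`mem_of_isHenselianField_of_forall_exists_valuation_sub_lt` with
`Kuhlmann2010HenselizationIsHenselian_holds` / `…Immediate_holds` —, is generated by a Hensel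
root (`KuhlmannNovacoski2014_Thm12_holds`), hence is strongly smoothly `O_L`-uniformizable by
Lemma 3.7 (2), `isSmoothlyUniformizableIn_of_henselRoot`).
[cite: KnafKuhlmann2009, Prop. 3.11 and Lemma 3.7] -/
theorem stub_denseAlgStep {Ω : Type} [Field Ω] [IsAlgClosed Ω] (V : ValuationSubring Ω)
    (L F : Subfield Ω) (hLF : L ≤ F) (hfin : FiniteSeparableOver L F) (hdense : IsDenseIn V L F)
    (Z : Finset Ω) (hZ : ∀ w ∈ Z, w ∈ V ∧ w ∈ F) :
    IsSmoothlyUniformizableIn ↥(V.toSubring ⊓ L.toSubring) V F (Z : Set Ω) :=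
  Summit.ResolutionOfSingularities.ResolutionOfSingularities.Theorems.stub_denseAlgStep
    V L F hLF hfin hdense Z hZ

/-- **LANDED (p156263, `Theorems/AbhyankarShadowsShadowsUniformizePullback.lean`): pull-back of strong smooth uniformizability to a regular model over `R`.** If `K`,
embedded in `Ω` with `O = V ∩ K`, is strongly smoothly `k`-uniformizable in the ambient sense,
then every finitely generated `R ⊆ O` lies in a finitely generated `A ⊆ O` with `Frac A = K`
regular at the centre (`exists_smooth_model` with `Z =` generators of `R` and of `K`,
`isRegularLocalRing_of_isSmoothAt`, pull back along `K → Ω` as in `Cutkosky2022_Thm13_holds`).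
[cite: KnafKuhlmann2009, Section 3.1 (p. 14)] -/
theorem stub_pullback (k K Ω : Type) [Field k] [Field K] [Algebra k K] [Field Ω] [Algebra K Ω]
    [Algebra k Ω] [IsScalarTower k K Ω] (O : ValuationSubring K) (V : ValuationSubring Ω)
    (hV : V.comap (algebraMap K Ω) = O) (hk : ∀ c : k, algebraMap k K c ∈ O)
    (R : Subalgebra k K) (hR : R.FG) (hRO : R.toSubring ≤ O.toSubring)
    (hSU : ∀ Z : Finset Ω, (∀ z ∈ Z, z ∈ V ∧ z ∈ (algebraMap K Ω).fieldRange) →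
      IsSmoothlyUniformizableIn (algebraMap k Ω).fieldRange V (algebraMap K Ω).fieldRange
        (Z : Set Ω)) :
    ∃ (A : Subalgebra k K) (h : A.toSubring ≤ O.toSubring), R ≤ A ∧ A.FG ∧
      IsFractionRing A K ∧ IsRegularLocalRing
        (Localization.AtPrime (Ideal.comap (Subring.inclusion h) (IsLocalRing.maximalIdeal O))) :=
  Summit.ResolutionOfSingularities.ResolutionOfSingularities.Theorems.stub_pullback
    k K Ω O V hV hk R hR hRO hSU

/-! ### The discrete assembly (lead, c1): degenerate case, uniformizer, base, tower, transport -/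

/-- **Degenerate case: the trivial valuation ring.** If every non-zero element of `K` has value
`1` then `O = K` is a localisation of any affine model `B` of `K/k`, and relative local
uniformization is free (`lurel_of_essFiniteType`). [folklore] -/
theorem lurel_of_valuation_eq_one {k K : Type} [Field k] [Field K] [Algebra k K]
    (hfg : (⊤ : IntermediateField k K).FG) (O : ValuationSubring K)
    (hk : ∀ c : k, algebraMap k K c ∈ O) (htriv : ∀ x : K, x ≠ 0 → O.valuation x = 1)
    (R : Subalgebra k K) (hR : R.FG) (hRO : R.toSubring ≤ O.toSubring) :
    ∃ (A : Subalgebra k K) (h : A.toSubring ≤ O.toSubring), R ≤ A ∧ A.FG ∧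
      IsFractionRing A K ∧ IsRegularLocalRing
        (Localization.AtPrime (Ideal.comap (Subring.inclusion h) (IsLocalRing.maximalIdeal O))) := by
  classical
  obtain ⟨B, hBO, hBfg, hBfrac⟩ := exists_affineModel k K hfg O hk
  haveI := hBfrac
  have hmemO : ∀ x : K, x ∈ O := by
    intro x
    by_cases hx : x = 0
    · rw [hx]; exact O.zero_mem
    · exact (O.valuation_le_one_iff x).mp (htriv x hx).le
  have hloc : ∀ x : K, x ∈ O → ∃ b ∈ B, ∃ s ∈ B, s ≠ 0 ∧ s⁻¹ ∈ O ∧ x = b * s⁻¹ := by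
    intro x _
    obtain ⟨a, s, hs, hx⟩ := IsFractionRing.div_surjective (A := B) x
    have hs0 : (s : K) ≠ 0 := by
      have := nonZeroDivisors.ne_zero hs
      exact fun h => this (Subtype.ext h)
    refine ⟨a, a.2, s, s.2, hs0, hmemO _, ?_⟩
    rw [← hx, div_eq_mul_inv]
    rfl
  obtain ⟨A, hAO, hRA, hBA, hAfg, hreg⟩ := lurel_of_essFiniteType O B hBfg hBO hloc R hR hRO
  refine ⟨A, hAO, hRA, hAfg, ?_, hreg⟩
  refine isFractionRing_of_forall_exists_div A.toSubring fun z => ?_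
  obtain ⟨a, s, _, hz⟩ := IsFractionRing.div_surjective (A := B) z
  exact ⟨a, hBA a.2, s, hBA s.2, by rw [← hz]; rfl⟩

/-- **A uniformizer from a cyclic value group.** If `(O.ValueGroup)ˣ` is cyclic and `O ≠ K`,
there is `t ∈ K` with `0 < v t < 1` such that every non-zero value is an integer power of
`v t`. [folklore] -/
theorem exists_uniformizer_of_isCyclic {K : Type} [Field K] (O : ValuationSubring K)
    (hcyc : IsCyclic (O.ValueGroup)ˣ) (hnt : ∃ x : K, x ≠ 0 ∧ O.valuation x ≠ 1) :
    ∃ t : K, t ≠ 0 ∧ O.valuation t < 1 ∧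
      ∀ y : K, y ≠ 0 → ∃ m : ℤ, O.valuation y = O.valuation t ^ m := by
  obtain ⟨g, hg⟩ := hcyc.exists_generator
  -- the generator is not `1`
  have hg1 : (g : O.ValueGroup) ≠ 1 := by
    intro h1
    obtain ⟨x, hx0, hx1⟩ := hnt
    have hu : Units.mk0 (O.valuation x) ((map_ne_zero O.valuation).mpr hx0) ∈ Subgroup.zpowers g :=
      hg _
    obtain ⟨m, hm⟩ := Subgroup.mem_zpowers_iff.mp hu
    apply hx1
    have := congrArg Units.val hm
    rw [Units.val_zpow_eq_zpow_val, h1, one_zpow] at this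
    simpa using this.symm
  -- normalise the generator below `1`
  obtain ⟨u, hu1, hugen⟩ : ∃ u : (O.ValueGroup)ˣ, (u : O.ValueGroup) < 1 ∧
      ∀ w : (O.ValueGroup)ˣ, w ∈ Subgroup.zpowers u := by
    rcases lt_or_gt_of_ne hg1 with hlt | hgt
    · exact ⟨g, hlt, hg⟩
    · refine ⟨g⁻¹, ?_, fun w => ?_⟩
      · rw [Units.val_inv_eq_inv_val]
        exact inv_lt_one_of_one_lt₀ hgt
      · rw [Subgroup.zpowers_inv]; exact hg w
  obtain ⟨t, ht⟩ := O.valuation_surjective (u : O.ValueGroup)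
  have ht0 : t ≠ 0 := by
    intro h0
    rw [h0, map_zero] at ht
    exact u.ne_zero ht.symm
  refine ⟨t, ht0, ht ▸ hu1, fun y hy0 => ?_⟩
  obtain ⟨m, hm⟩ := Subgroup.mem_zpowers_iff.mp
    (hugen (Units.mk0 (O.valuation y) ((map_ne_zero O.valuation).mpr hy0)))
  refine ⟨m, ?_⟩
  have := congrArg Units.val hm
  rw [Units.val_zpow_eq_zpow_val] at this
  rw [ht]
  simpa using this.symm

/-- **The base of the tower**: the rational function field `k'(t)` of an element of value `< 1`
is strongly smoothly uniformizable over the trivially valued constants `k' ⊆ O_V` (Knaf–Kuhlmann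
2005, Thm. 1.1 for `ρ = 1`, `τ = 0`: `isSmoothlyUniformizableIn_rational`).
[cite: KnafKuhlmann2005, Thm. 1.1] -/
theorem base_rational {Ω : Type} [Field Ω] (V : ValuationSubring Ω)
    (k' : Subfield Ω) (hkV : (k' : Set Ω) ⊆ V) {t : Ω} (ht0 : t ≠ 0) (ht1 : V.valuation t < 1)
    (Z : Finset Ω) (hZ : ∀ z ∈ Z, z ∈ V ∧ z ∈ Subfield.closure ((k' : Set Ω) ∪ {t})) :
    IsSmoothlyUniformizableIn ↥(V.toSubring ⊓ k'.toSubring) V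
      (Subfield.closure ((k' : Set Ω) ∪ {t})) (Z : Set Ω) := by
  classical
  have hkV' : ∀ c ∈ k', c ∈ V := fun c hc => hkV hc
  let x : Fin 1 → Ω := fun _ => t
  let y : Fin 0 → Ω := fun j => j.elim0
  have hy : ∀ j, y j ∈ V := fun j => j.elim0
  have hset : ((k' : Set Ω) ∪ (Set.range x ∪ Set.range y)) = (k' : Set Ω) ∪ {t} := by
    rw [Set.range_const, Set.range_eq_empty y, Set.union_empty]
  have hvt0 : V.valuation t ≠ 0 := (map_ne_zero V.valuation).mpr ht0
  have hxi : ∀ m : Fin 1 → ℤ,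
      (∃ b ∈ k', (∏ i, V.valuation (x i) ^ (m i)) = V.valuation b) → m = 0 := by
    rintro m ⟨b, hbk, hb⟩
    rw [Fin.prod_univ_one] at hb
    change V.valuation t ^ m 0 = V.valuation b at hb
    by_cases hb0 : b = 0
    · rw [hb0, map_zero] at hb
      exact absurd hb (zpow_ne_zero _ hvt0)
    · rw [valuation_eq_one_of_subfield_subset V hkV' hbk hb0,
        zpow_eq_one_iff_right₀ zero_le (ne_of_lt ht1)] at hb
      funext i
      fin_cases i
      exact hb
  have hri : AlgebraicIndependent (resField V k') (fun j => IsLocalRing.residue V ⟨y j, hy j⟩) :=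
    algebraicIndependent_empty_type_iff.mpr
      (algebraMap (resField V k') (IsLocalRing.ResidueField V)).injective
  have h := isSmoothlyUniformizableIn_rational V k' hkV' x y (fun _ => ht0) hxi hy hri Z
    (by rw [hset]; exact hZ)
  rw [hset] at h
  exact (isSmoothlyUniformizableIn_inf_iff V k' hkV _ _).mpr h

/-- **Knaf–Kuhlmann 2009, Prop. 3.11 with Thm. 1.5, discrete rational case, ambient form**
(from the four ambient stub statements): for `k' ≤ K'` subfields of an algebraically closed valued
field `(Ω, V)`, `k'` perfect and `⊆ O_V`, `K'|k'` finitely generated, `t ∈ K'` a uniformizer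
(`0 < v t < 1`, all non-zero values of `K'` powers of `v t`) and `O_V ∩ K'` rational over `k'`,
every finite `Z ⊆ O_V ∩ K'` is smoothly `O_{k'}`-uniformizable: separating tower led by `t'`
(`stub_uniformizer_separating`), density of `k'(t')` (`stub_discrete_isDenseIn`), base
`base_rational`, transcendental steps (`stub_denseTranscStep`) and the final separable-algebraic
step (`stub_denseAlgStep`) stacked by Cor. 3.6 (`knafKuhlmann2009_cor36`).
[cite: KnafKuhlmann2009, Prop. 3.11 and Thm. 1.5] -/
theorem ambient_discrete (h₁ : Sig.stub_discrete_isDenseIn) (h₂ : Sig.stub_uniformizer_separating)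
    (h₃ : Sig.stub_denseTranscStep) (h₄ : Sig.stub_denseAlgStep)
    {Ω : Type} [Field Ω] [IsAlgClosed Ω] (V : ValuationSubring Ω) (k' K' : Subfield Ω)
    [PerfectField k'] (t : Ω) (hkK : k' ≤ K') (hfg : FGOver k' K') (hkV : (k' : Set Ω) ⊆ V)
    (ht : t ∈ K') (ht0 : t ≠ 0) (ht1 : V.valuation t < 1)
    (hrat : ∀ y ∈ K', y ∈ V → ∃ c ∈ k', V.valuation (y - c) < 1)
    (hdisc : ∀ y ∈ K', y ≠ 0 → ∃ m : ℤ, V.valuation y = V.valuation t ^ m)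
    (Z : Finset Ω) (hZ : ∀ z ∈ Z, z ∈ V ∧ z ∈ K') :
    IsSmoothlyUniformizableIn ↥(V.toSubring ⊓ k'.toSubring) V K' (Z : Set Ω) := by
  classical
  -- the separating tower led by `t'`
  obtain ⟨t', n, x, ht'K, hvt', hxK, htransc, hfinsep⟩ :=
    h₂ V k' K' t hkK hfg hkV ht ht1 hdisc
  have ht'1 : V.valuation t' < 1 := hvt' ▸ ht1
  have ht'0 : t' ≠ 0 := by
    intro h0
    rw [h0, map_zero] at hvt'
    exact (map_ne_zero V.valuation).mpr ht0 hvt'.symm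
  have hdisc' : ∀ y ∈ K', y ≠ 0 → ∃ m : ℤ, V.valuation y = V.valuation t' ^ m := by
    rw [hvt']; exact hdisc
  -- density of `k'(t')`
  have hdense : IsDenseIn V (Subfield.closure ((k' : Set Ω) ∪ {t'})) K' :=
    h₁ V k' K' t' hkK hkV ht'K ht'1 hrat hdisc'
  -- the tower
  let E : ℕ → Subfield Ω := fun i =>
    Subfield.closure ((k' : Set Ω) ∪ insert t' (x '' {j : Fin n | (j : ℕ) < i}))
  have hE0 : E 0 = Subfield.closure ((k' : Set Ω) ∪ {t'}) := by
    simp only [E]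
    congr
    rw [show {j : Fin n | (j : ℕ) < 0} = ∅ from
        Set.eq_empty_of_forall_notMem fun j hj => by simp at hj,
      Set.image_empty, ← Set.singleton_def]
  have hkE : ∀ i, k' ≤ E i := fun i c hc => Subfield.subset_closure (Or.inl hc)
  have ht'E : ∀ i, t' ∈ E i := fun i => Subfield.subset_closure (Or.inr (Set.mem_insert _ _))
  have hE0le : ∀ i, Subfield.closure ((k' : Set Ω) ∪ {t'}) ≤ E i := by
    intro i
    refine Subfield.closure_le.mpr ?_
    rintro z (hz | hz)
    · exact hkE i hz
    · rw [Set.mem_singleton_iff.mp hz]; exact ht'E i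
  have hEK : ∀ i, E i ≤ K' := by
    intro i
    refine Subfield.closure_le.mpr ?_
    rintro z (hz | hz)
    · exact hkK hz
    · rcases Set.mem_insert_iff.mp hz with hz | ⟨j, -, rfl⟩
      · rw [hz]; exact ht'K
      · exact hxK j
  have hEmono : ∀ i, E i ≤ E (i + 1) := by
    intro i
    refine Subfield.closure_mono (Set.union_subset_union_right _ (Set.insert_subset_insert
      (Set.image_mono fun j (hj : (j : ℕ) < i) => ?_)))
    exact Nat.lt_succ_of_lt hj
  have hEstep : ∀ i : Fin n,
      E ((i : ℕ) + 1) = Subfield.closure (((E i : Subfield Ω) : Set Ω) ∪ {x i}) := by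
    intro i
    refine le_antisymm ?_ ?_
    · refine Subfield.closure_le.mpr ?_
      rintro z (hz | hz)
      · exact Subfield.subset_closure (Or.inl (hkE i hz))
      · rcases Set.mem_insert_iff.mp hz with hz | ⟨j, hj, rfl⟩
        · rw [hz]; exact Subfield.subset_closure (Or.inl (ht'E i))
        · change (j : ℕ) < i + 1 at hj
          rcases Nat.lt_succ_iff_lt_or_eq.mp hj with hj | hj
          · exact Subfield.subset_closure (Or.inl (Subfield.subset_closure
              (Or.inr (Set.mem_insert_of_mem _ ⟨j, hj, rfl⟩))))
          · rw [Fin.ext hj]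
            exact Subfield.subset_closure (Or.inr rfl)
    · refine Subfield.closure_le.mpr ?_
      rintro z (hz | hz)
      · exact hEmono i hz
      · rw [Set.mem_singleton_iff.mp hz]
        exact Subfield.subset_closure
          (Or.inr (Set.mem_insert_of_mem _ ⟨i, Nat.lt_succ_self _, rfl⟩))
  have hEtop : E n = Subfield.closure ((k' : Set Ω) ∪ insert t' (Set.range x)) := by
    simp only [E]
    congr
    ext z
    constructor
    · rintro ⟨j, -, rfl⟩; exact ⟨j, rfl⟩
    · rintro ⟨j, rfl⟩; exact ⟨j, j.2, rfl⟩
  -- density along the tower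
  have hdenseE : ∀ i, ∀ F : Subfield Ω, F ≤ K' → IsDenseIn V (E i) F := by
    intro i F hF y hy c hc hc0
    obtain ⟨z, hz, hlt⟩ := hdense y (hF hy) c (hF hc) hc0
    exact ⟨z, hE0le i hz, hlt⟩
  -- the induction
  have hQ : ∀ i, i ≤ n → ∀ Z : Finset Ω, (∀ z ∈ Z, z ∈ V ∧ z ∈ E i) →
      IsSmoothlyUniformizableIn ↥(V.toSubring ⊓ k'.toSubring) V (E i) (Z : Set Ω) := by
    intro i
    induction i with
    | zero =>
      intro _ Z hZ
      rw [hE0] at hZ ⊢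
      exact base_rational V k' hkV ht'0 ht'1 Z hZ
    | succ i ih =>
      intro hi Z hZ
      have hi' : i < n := Nat.lt_of_succ_le hi
      let i' : Fin n := ⟨i, hi'⟩
      refine knafKuhlmann2009_cor36 V (hkE i) (hEmono i) (ih hi'.le) ?_ Z hZ
      intro Z' hZ'
      have hstep := hEstep i'
      change E (i + 1) = _ at hstep
      rw [hstep] at hZ' ⊢
      refine h₃ V (E i) (x i') (fun P hP hP0 => htransc i' P (fun m => ?_) hP0)
        (hdenseE i _ (hstep ▸ hEK (i + 1))) Z' hZ'
      exact hP m
  -- the last, separable-algebraic step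
  have hEn : E n ≤ K' := hEK n
  refine knafKuhlmann2009_cor36 V (hkE n) hEn (hQ n le_rfl) ?_ Z hZ
  intro Z' hZ'
  refine h₄ V (E n) K' hEn ?_ (hdenseE n K' le_rfl) Z' hZ'
  rw [hEtop]
  exact hfinsep

/-- **The discrete branch, typed** (`Sig.lurelDiscrete` from the five discrete stub statements):
`O = K` is the degenerate case; otherwise take a uniformizer (`exists_uniformizer_of_isCyclic`),
embed `K ↪ Ω = K̄`, extend `O` to `V` (Chevalley, `exists_valuationSubring_comap_eq`), transport
finite generation, rationality and discreteness to the subfields `k' ≤ K'` of `Ω`, apply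
`ambient_discrete`, pass to the field base (`isSmoothlyUniformizableIn_inf_iff`) and pull back
(`stub_pullback`). [cite: KnafKuhlmann2009, Thm. 1.5] -/
theorem stub_discreteAssembly : Sig.stub_discreteAssembly := by
  intro h₁ h₂ h₃ h₄ h₅ p hp k K _ _ _ _ _ hfg O hk hrat hcyc R hR hRO
  classical
  by_cases hnt : ∃ x : K, x ≠ 0 ∧ O.valuation x ≠ 1
  swap
  · push Not at hnt
    exact lurel_of_valuation_eq_one hfg O hk hnt R hR hRO
  obtain ⟨t, ht0, ht1, hdisc⟩ := exists_uniformizer_of_isCyclic O hcyc hnt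
  -- ambient data: `Ω = K̄`, `V` over `O`
  let Ω : Type := AlgebraicClosure K
  obtain ⟨V, hV⟩ := exists_valuationSubring_comap_eq (Ω := Ω) O
  subst hV
  set ι : K →+* Ω := algebraMap K Ω with hιdef
  set k' : Subfield Ω := (algebraMap k Ω).fieldRange with hk'def
  set K' : Subfield Ω := ι.fieldRange with hK'def
  have hιk : ∀ c : k, ι (algebraMap k K c) = algebraMap k Ω c := fun c =>
    (IsScalarTower.algebraMap_apply k K Ω c).symm
  have hmemV : ∀ z : K, ι z ∈ V ↔ z ∈ V.comap ι := fun z => ValuationSubring.mem_comap.symm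
  have hlt1 : ∀ z : K, V.valuation (ι z) < 1 ↔ (V.comap ι).valuation z < 1 := fun z =>
    (comap_valuation_lt_one_iff V ι z).symm
  have heq1 : ∀ z : K, z ∈ V.comap ι → (V.valuation (ι z) = 1 ↔ (V.comap ι).valuation z = 1) :=
    fun z hz => (comap_valuation_eq_one_iff V ι hz).symm
  have hkK : k' ≤ K' := by
    rintro _ ⟨c, rfl⟩
    exact ⟨algebraMap k K c, hιk c⟩
  have hkV : (k' : Set Ω) ⊆ V := by
    rintro _ ⟨c, rfl⟩
    rw [← hιk]
    exact (hmemV _).mpr (hk c)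
  have htK' : ι t ∈ K' := ⟨t, rfl⟩
  have hιt0 : ι t ≠ 0 := (map_ne_zero ι).mpr ht0
  have ht1' : V.valuation (ι t) < 1 := (hlt1 t).mpr ht1
  have hdisc' : ∀ y ∈ K', y ≠ 0 → ∃ m : ℤ, V.valuation y = V.valuation (ι t) ^ m := by
    rintro _ ⟨y, rfl⟩ hy0
    have hy0' : y ≠ 0 := fun h => hy0 (by rw [h, map_zero])
    obtain ⟨m, hm⟩ := hdisc y hy0'
    refine ⟨m, ?_⟩
    have h1 : (V.comap ι).valuation (y / t ^ m) = 1 := by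
      rw [map_div₀, map_zpow₀, ← hm, div_self ((map_ne_zero _).mpr hy0')]
    have hmem : y / t ^ m ∈ V.comap ι := ((V.comap ι).valuation_le_one_iff _).mp h1.le
    have h2 : V.valuation (ι (y / t ^ m)) = 1 := (heq1 _ hmem).mpr h1
    rwa [map_div₀, map_div₀, map_zpow₀, map_zpow₀,
      div_eq_one_iff_eq (zpow_ne_zero m ((map_ne_zero _).mpr hιt0))] at h2
  have hrat' : ∀ y ∈ K', y ∈ V → ∃ c ∈ k', V.valuation (y - c) < 1 := by
    rintro _ ⟨y, rfl⟩ hyV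
    obtain ⟨c, hc⟩ := hrat y ((hmemV y).mp hyV)
    refine ⟨algebraMap k Ω c, ⟨c, rfl⟩, ?_⟩
    rw [← hιk, ← map_sub]
    exact (hlt1 _).mpr hc
  have hfgΩ : FGOver k' K' := by
    set K₀ : Subfield K := (algebraMap k K).fieldRange with hK₀
    have hfg₀ : FGOver K₀ (⊤ : Subfield K) := by
      obtain ⟨s, hs⟩ := hfg
      refine ⟨s, ?_⟩
      have h1 : (IntermediateField.adjoin k (s : Set K)).toSubfield =
          Subfield.closure (Set.range (algebraMap k K) ∪ (s : Set K)) := rfl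
      rw [RingHom.coe_fieldRange, ← h1, hs]
      rfl
    have h := fgOver_map ι hfg₀
    have hk'eq : K₀.map ι = k' := by
      ext z
      simp only [Subfield.mem_map, RingHom.mem_fieldRange, hK₀]
      constructor
      · rintro ⟨_, ⟨c, rfl⟩, rfl⟩; exact ⟨c, (hιk c).symm⟩
      · rintro ⟨c, rfl⟩; exact ⟨_, ⟨c, rfl⟩, hιk c⟩
    have hK'eq : (⊤ : Subfield K).map ι = K' := by
      rw [hK'def, RingHom.fieldRange_eq_map]
    rwa [hk'eq, hK'eq] at h
  haveI : IsAlgClosed k' := IsAlgClosed.of_ringEquiv k k' (algebraMap k Ω).rangeRestrictFieldEquiv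
  haveI : PerfectField k' := inferInstance
  have hSU : ∀ Z : Finset Ω, (∀ z ∈ Z, z ∈ V ∧ z ∈ K') →
      IsSmoothlyUniformizableIn k' V K' (Z : Set Ω) := fun Z hZ =>
    (isSmoothlyUniformizableIn_inf_iff V k' hkV K' _).mp
      (ambient_discrete h₁ h₂ h₃ h₄ V k' K' (ι t) hkK hfgΩ hkV htK' hιt0 ht1' hrat' hdisc' Z hZ)
  exact h₅ k K Ω (V.comap ι) V rfl hk R hR hRO hSU

/-! ### The certifying half (cycle 0; all three LANDED) -/

/-- **LANDED (p150824): the frame's quotient is the shadow's local ring.** [folklore] -/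
theorem stub_frameQuotientEquiv (k K L : Type) [Field k] [Field K] [Algebra k K] [Field L]
    [Algebra k L] (O : ValuationSubring K) (A : Subalgebra k K) (h : A.toSubring ≤ O.toSubring)
    (ψ : A →ₐ[k] L) (O' : ValuationSubring L) (hψ : ψ.range.toSubring ≤ O'.toSubring)
    (hcentre : ∀ a : A, O'.valuation (ψ a) < 1 ↔ O.valuation (a : K) < 1) :
    (Ideal.map (algebraMap A.toSubring (Localization.AtPrime
        (Ideal.comap (Subring.inclusion h) (IsLocalRing.maximalIdeal O)))) (RingHom.ker ψ)).IsPrime ∧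
    Nonempty ((Localization.AtPrime (Ideal.comap (Subring.inclusion h) (IsLocalRing.maximalIdeal O)) ⧸
        Ideal.map (algebraMap A.toSubring (Localization.AtPrime
          (Ideal.comap (Subring.inclusion h) (IsLocalRing.maximalIdeal O)))) (RingHom.ker ψ)) ≃+*
      Localization.AtPrime (Ideal.comap (Subring.inclusion hψ) (IsLocalRing.maximalIdeal O'))) :=
  Summit.ResolutionOfSingularities.ResolutionOfSingularities.Theorems.stub_frameQuotientEquiv
    k K L O A h ψ O' hψ hcentre

/-- **LANDED (p151618): the shadow's local ring is regular.**
[cite: KnafKuhlmann2005, Thm. 2.1; Matsumura1987, Thm. 5.6] -/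
theorem stub_shadowLocalRing_regular (k L : Type) [Field k] [Field L] [Algebra k L]
    (O' : ValuationSubring L) (C : Subalgebra k L) (hC : C.toSubring ≤ O'.toSubring) (hCfg : C.FG)
    (hrat : ∀ z : L, z ∈ O' → ∃ c : k, O'.valuation (z - algebraMap k L c) < 1)
    (r : ℕ) (y : Fin r → L) (hy : ∀ i, y i ∈ C) (hvi : IsValueIndependent O' y)
    (hspan : IsLocalRing.maximalIdeal
        (Localization.AtPrime (Ideal.comap (Subring.inclusion hC) (IsLocalRing.maximalIdeal O'))) =
      Ideal.span (Set.range fun i => algebraMap C.toSubring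
        (Localization.AtPrime (Ideal.comap (Subring.inclusion hC) (IsLocalRing.maximalIdeal O')))
        ⟨y i, hy i⟩)) :
    IsRegularLocalRing
      (Localization.AtPrime (Ideal.comap (Subring.inclusion hC) (IsLocalRing.maximalIdeal O'))) :=
  Summit.ResolutionOfSingularities.ResolutionOfSingularities.Theorems.stub_shadowLocalRing_regular
    k L O' C hC hCfg hrat r y hy hvi hspan

/-- **LANDED (p152251): regularity lifts along a complete-intersection prime.**
[cite: Matsumura1987, §5 p. 31 and Thm. 14.2] -/
theorem stub_regular_of_regularQuotient_ci (k K : Type) [Field k] [Field K] [Algebra k K]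
    (A : Subalgebra k K) (hA : A.FG) (P : Ideal A.toSubring) [P.IsPrime]
    (Q : Ideal (Localization.AtPrime P)) [Q.IsPrime]
    (hreg : IsRegularLocalRing (Localization.AtPrime P ⧸ Q))
    (S : Finset (Localization.AtPrime P)) (hS : Ideal.span (S : Set (Localization.AtPrime P)) = Q)
    (hcard : (S.card : ℕ∞) = Q.height) :
    IsRegularLocalRing (Localization.AtPrime P) :=
  Summit.ResolutionOfSingularities.ResolutionOfSingularities.Theorems.stub_regular_of_regularQuotient_ci
    k K A hA P Q hreg S hS hcard

/-! ## The composition (kernel-checked; no `sorry` in its own terms) -/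

/-- **Regularity from a toric shadow frame, from the three certifying stub statements.**
[cite: KnafKuhlmann2005, Section 2; Matsumura1987, Thm. 5.6, Thm. 15.1] -/
theorem regular_of_shadowFrame_of (h₂ : Sig.stub_frameQuotientEquiv)
    (h₃ : Sig.stub_shadowLocalRing_regular) (h₄ : Sig.stub_regular_of_regularQuotient_ci) :
    Sig.stub_regular_of_shadowFrame := by
  intro k K _ _ _ O A h hA hframe
  obtain ⟨L, _, _, ψ, O', hψ, hrat', hcentre, r, x, _hr, hvi, hspan, S, hS, hcard⟩ := hframe
  obtain ⟨hQ, ⟨e⟩⟩ := h₂ k K L O A h ψ O' hψ hcentre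
  have hCfg : ψ.range.FG := by
    have hAft : Algebra.FiniteType k A := A.fg_iff_finiteType.mp hA
    exact ψ.range.fg_iff_finiteType.mpr
      (hAft.of_surjective ψ.rangeRestrict ψ.rangeRestrict_surjective)
  have hD : IsRegularLocalRing (Localization.AtPrime
      (Ideal.comap (Subring.inclusion hψ) (IsLocalRing.maximalIdeal O'))) :=
    h₃ k L O' ψ.range hψ hCfg hrat' r (fun i => ψ (x i)) (fun i => ψ.mem_range_self (x i)) hvi hspan
  haveI := hQ
  have hBQ : IsRegularLocalRing
      (Localization.AtPrime (Ideal.comap (Subring.inclusion h) (IsLocalRing.maximalIdeal O)) ⧸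
        Ideal.map (algebraMap A.toSubring (Localization.AtPrime
          (Ideal.comap (Subring.inclusion h) (IsLocalRing.maximalIdeal O)))) (RingHom.ker ψ)) :=
    IsRegularLocalRing.of_ringEquiv e.symm
  exact h₄ k K A hA _ _ hBQ S hS hcard

/-- **Regularity from a toric shadow frame** — kernel-closed (the three certifying stubs landed).
[cite: KnafKuhlmann2005, Section 2; Matsumura1987, Thm. 5.6, Thm. 15.1] -/
theorem regular_of_shadowFrame : Sig.stub_regular_of_shadowFrame :=
  regular_of_shadowFrame_of stub_frameQuotientEquiv stub_shadowLocalRing_regular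
    stub_regular_of_regularQuotient_ci

/-- **The discrete branch — relative local uniformization at DISCRETE rational places, PROVED**
(all five discrete stubs have LANDED; the assembly `stub_discreteAssembly` is proved above): for
`k` algebraically closed of characteristic `p`, `K/k` finitely generated, `O ∋ k` a rational
valuation ring of `K` with cyclic value group and `R ⊆ O` finitely generated, some finitely
generated `A` with `R ≤ A ⊆ O`, `Frac A = K`, is regular at the centre of `O` (Knaf–Kuhlmann
2009, Thm. 1.5: `K` lies in the completion of the Abhyankar subfield `k(t)`).
[cite: KnafKuhlmann2009, Thm. 1.5 and Prop. 3.11] -/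
theorem lurelDiscrete : Sig.lurelDiscrete :=
  stub_discreteAssembly stub_discrete_isDenseIn stub_uniformizer_separating stub_denseTranscStep
    stub_denseAlgStep stub_pullback

/-- **The dense-Abhyankar branch — relative local uniformization at the rational places in the
completion of an Abhyankar subfunction field** (Knaf–Kuhlmann 2009, Thm. 1.5 for `P|_K = id`,
`K` algebraically closed of characteristic `p`), from the registered dense-Abhyankar stubs.
[cite: KnafKuhlmann2009, Thm. 1.5] -/
theorem lurelDenseAbhyankar : Sig.lurelDenseAbhyankar :=
  stub_denseAbhyankarAssembly stub_isAbhyankarPlace_map stub_linDisjoint_of_dense_defectless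
    stub_separablyGenerated_of_linDisjoint stub_separatingTower stub_denseTower_ambient
    stub_pullback

/-! ### The composite-discrete branch (lead c2, reshape #3): Novacoski–Spivakovsky composition -/

/-- **LANDED (p163332, `Theorems/AbhyankarShadowsShadowsUniformizeComposite.lean`; Novacoski–Spivakovsky 2014, §3.1 per valuation): composition `ν = ν₁ ∘ ν₂` in the crux's
affine-model shape.** For `k ⊆ O ≤ O₁` valuation rings of the function field `K/k` with the residue
field `κ(O₁)` generated over `k` by residues of finitely many elements of `O` (`hgen`): IF `O₁`
admits relative local uniformization on `K/k` (`h₁`, crux shape) and the residue valuation ring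
`O / m_{O₁}` admits it on `κ(O₁)` read through any `k`-compatible SURJECTIVE `ι : κ → κ(O₁)` (`h₂`),
THEN `O` admits it: enlarge `R` by an affine model of `K` (`exists_affineModel`) and by the lifts
`S` (so that the residues of every model generate `κ(O₁)`, making cor217's `ι` surjective), then
`novacoskiSpivakovsky2014_cor214` (with `h₁`), `novacoskiSpivakovsky2014_cor217` (with `h₂`) and
`novacoskiSpivakovsky2014_step`. [cite: NovacoskiSpivakovsky2014, Thm. 1.1 (§3.1), Cor. 2.14, Cor. 2.17] -/
theorem stub_lurel_of_composite (k K : Type) [Field k] [Field K] [Algebra k K]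
    (hfg : (⊤ : IntermediateField k K).FG) (O O₁ : ValuationSubring K) (hO : O ≤ O₁)
    (hk : ∀ c : k, algebraMap k K c ∈ O)
    (hgen : ∃ S : Finset O, ∀ T : Subfield (IsLocalRing.ResidueField O₁),
      (∀ c : k, IsLocalRing.residue O₁ ⟨algebraMap k K c, hO (hk c)⟩ ∈ T) →
      (∀ s ∈ S, IsLocalRing.residue O₁ ⟨(s : K), hO s.2⟩ ∈ T) → T = ⊤)
    (h₁ : ∀ R : Subalgebra k K, R.FG → R.toSubring ≤ O₁.toSubring →
      ∃ (A : Subalgebra k K) (h : A.toSubring ≤ O₁.toSubring), R ≤ A ∧ A.FG ∧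
        IsFractionRing A K ∧ IsRegularLocalRing
          (Localization.AtPrime (Ideal.comap (Subring.inclusion h) (IsLocalRing.maximalIdeal O₁))))
    (h₂ : ∀ (κ : Type) [Field κ] [Algebra k κ] (ι : κ →+* IsLocalRing.ResidueField O₁),
      Function.Surjective ι →
      (∀ c : k, ι (algebraMap k κ c) = IsLocalRing.residue O₁ ⟨algebraMap k K c, hO (hk c)⟩) →
      ∀ R : Subalgebra k κ, R.FG →
        R.toSubring ≤ ((residueValuationSubring O O₁ hO).comap ι).toSubring →
        ∃ (B : Subalgebra k κ) (hB : B.toSubring ≤ ((residueValuationSubring O O₁ hO).comap ι).toSubring),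
          R ≤ B ∧ B.FG ∧ IsRegularLocalRing (Localization.AtPrime (Ideal.comap (Subring.inclusion hB)
            (IsLocalRing.maximalIdeal ((residueValuationSubring O O₁ hO).comap ι)))))
    (R : Subalgebra k K) (hR : R.FG) (hRO : R.toSubring ≤ O.toSubring) :
    ∃ (A : Subalgebra k K) (h : A.toSubring ≤ O.toSubring), R ≤ A ∧ A.FG ∧
      IsFractionRing A K ∧ IsRegularLocalRing
        (Localization.AtPrime (Ideal.comap (Subring.inclusion h) (IsLocalRing.maximalIdeal O))) :=
  Summit.ResolutionOfSingularities.ResolutionOfSingularities.Theorems.stub_lurel_of_composite k K hfg O O₁ hO hk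
    hgen h₁ h₂ R hR hRO

/-- **LANDED (p163499, `Theorems/AbhyankarShadowsShadowsUniformizeCompositeResidueDiscrete.lean`): the residue side, discrete case.** For `k ⊆ O ≤ O₁` in `K` with `O` rational over the
algebraically closed `k`, `κ(O₁)` generated over `k` by residues of finitely many elements of `O`,
and the residue valuation ring `O₂ = O / m_{O₁}` of CYCLIC value group: through any `k`-compatible
surjective (hence bijective) `ι : κ → κ(O₁)`, the valuation ring `ι⁻¹(O₂)` of `κ` admits relative
local uniformization over `k` — `κ/k` is finitely generated, `ι⁻¹(O₂)` is rational (from `hrat` via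
`valuation_lt_one_iff_residue`) with cyclic value group, so `lurelRational_of_isCyclic_valueGroup`
(landed, c1) applies. [cite: KnafKuhlmann2009, Thm. 1.5] -/
theorem stub_composite_residue_discrete (p : ℕ) (hp : p.Prime) (k K : Type) [Field k] [CharP k p]
    [IsAlgClosed k] [Field K] [Algebra k K] (O O₁ : ValuationSubring K) (hO : O ≤ O₁)
    (hk : ∀ c : k, algebraMap k K c ∈ O)
    (hrat : ∀ x : K, x ∈ O → ∃ c : k, O.valuation (x - algebraMap k K c) < 1)
    (hgen : ∃ S : Finset O, ∀ T : Subfield (IsLocalRing.ResidueField O₁),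
      (∀ c : k, IsLocalRing.residue O₁ ⟨algebraMap k K c, hO (hk c)⟩ ∈ T) →
      (∀ s ∈ S, IsLocalRing.residue O₁ ⟨(s : K), hO s.2⟩ ∈ T) → T = ⊤)
    (hcyc : IsCyclic ((residueValuationSubring O O₁ hO).ValueGroup)ˣ)
    (κ : Type) [Field κ] [Algebra k κ] (ι : κ →+* IsLocalRing.ResidueField O₁)
    (hι : Function.Surjective ι)
    (hιk : ∀ c : k, ι (algebraMap k κ c) = IsLocalRing.residue O₁ ⟨algebraMap k K c, hO (hk c)⟩)
    (R : Subalgebra k κ) (hR : R.FG)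
    (hRO : R.toSubring ≤ ((residueValuationSubring O O₁ hO).comap ι).toSubring) :
    ∃ (B : Subalgebra k κ) (hB : B.toSubring ≤ ((residueValuationSubring O O₁ hO).comap ι).toSubring),
      R ≤ B ∧ B.FG ∧ IsRegularLocalRing (Localization.AtPrime (Ideal.comap (Subring.inclusion hB)
        (IsLocalRing.maximalIdeal ((residueValuationSubring O O₁ hO).comap ι)))) :=
  Summit.ResolutionOfSingularities.ResolutionOfSingularities.Theorems.stub_composite_residue_discrete p hp k K
    O O₁ hO hk hrat hgen hcyc κ ι hι hιk R hR hRO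

/-- **LANDED (p163456 as `stub_residue_gen_unfolded`, `Theorems/AbhyankarShadowsShadowsUniformizeResidueGen.lean`): finite generation of the residue field of the coarsening.** If `O₁ ⊇ O ∋ k` is an
Abhyankar place of `K/k` (Knaf–Kuhlmann 2005 Cor. 2.2: `κ(O₁) | k` finitely generated,
`KnafKuhlmann2005_Cor22_holds`) or lies in the dense-Abhyankar locus (the same for `K₀`, and
`κ(O₁ ∩ K₀) = κ(O₁)` by immediacy, `IsDenseIn.isImmediateOver`), then `κ(O₁)` is generated over `k`
by the residues of finitely many elements of `O` (a generator `r = residue y`, `y ∈ O₁ ∖ O`, is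
replaced by `r⁻¹ = residue y⁻¹`, `y⁻¹ ∈ m_O`). [cite: KnafKuhlmann2005, Cor. 2.2] -/
theorem stub_residue_gen (k K : Type) [Field k] [IsAlgClosed k] [Field K] [Algebra k K]
    (hfg : (⊤ : IntermediateField k K).FG) (O O₁ : ValuationSubring K) (hO : O ≤ O₁)
    (hk : ∀ c : k, algebraMap k K c ∈ O)
    (hA₁ : IsAbhyankarPlace O₁ (algebraMap k K).fieldRange ⊤ ∨ IsDenseAbhyankar (k := k) O₁) :
    ∃ S : Finset O, ∀ T : Subfield (IsLocalRing.ResidueField O₁),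
      (∀ c : k, IsLocalRing.residue O₁ ⟨algebraMap k K c, hO (hk c)⟩ ∈ T) →
      (∀ s ∈ S, IsLocalRing.residue O₁ ⟨(s : K), hO s.2⟩ ∈ T) → T = ⊤ :=
  Summit.ResolutionOfSingularities.ResolutionOfSingularities.Theorems.stub_residue_gen_unfolded k K hfg O O₁ hO hk hA₁

/-- **PROVED (lead c2; LANDED typed as `lurelRational_of_isCompositeDiscrete`, p163740, `Theorems/AbhyankarShadowsShadowsUniformizeLurelComposite.lean`): the composite-discrete branch, typed, from the three composite stub
statements**: `h₁` for the coarsening from `relLU_at_abhyankarPlace_of_perfectField` /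
`lurelDenseAbhyankar`, `hgen` from `stub_residue_gen`, `h₂` from `stub_composite_residue_discrete`,
composed by `stub_lurel_of_composite`. [cite: NovacoskiSpivakovsky2014, Thm. 1.1] -/
theorem stub_compositeAssembly : Sig.stub_compositeAssembly := by
  intro h₁₂ h₂ h₃ p hp k K _ _ _ _ _ hfg O hk hrat hC R hR hRO
  obtain ⟨O₁, hO, hA₁, hcyc⟩ := hC
  have hk₁ : ∀ c : k, algebraMap k K c ∈ O₁ := fun c => hO (hk c)
  have hLU₁ : ∀ R : Subalgebra k K, R.FG → R.toSubring ≤ O₁.toSubring →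
      ∃ (A : Subalgebra k K) (h : A.toSubring ≤ O₁.toSubring), R ≤ A ∧ A.FG ∧
        IsFractionRing A K ∧ IsRegularLocalRing
          (Localization.AtPrime (Ideal.comap (Subring.inclusion h) (IsLocalRing.maximalIdeal O₁))) := by
    intro R' hR' hR'O
    rcases hA₁ with hA₁ | hD₁
    · exact relLU_at_abhyankarPlace_of_perfectField hfg O₁ hk₁ hA₁ R' hR' hR'O
    · exact lurelDenseAbhyankar p hp k K hfg O₁ hk₁ hD₁ R' hR' hR'O
  have hgen := h₃ k K hfg O O₁ hO hk hA₁
  exact h₁₂ k K hfg O O₁ hO hk hgen hLU₁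
    (fun κ _ _ ι hι hιk => h₂ p hp k K O O₁ hO hk hrat hgen hcyc κ ι hι hιk) R hR hRO

/-- **The composite-discrete branch** (relative local uniformization at rational places composed of
an Abhyankar / dense-Abhyankar coarsening and a discrete residue valuation), from the registered
composite stubs. [cite: NovacoskiSpivakovsky2014, Thm. 1.1] -/
theorem lurelCompositeDiscrete : Sig.lurelCompositeDiscrete :=
  stub_compositeAssembly stub_lurel_of_composite stub_composite_residue_discrete stub_residue_gen

/-! ### The composite-uniformizable assembly (lead c3, reshape #4) -/

/-- **PROVED (lead c3; LANDED typed as `lurelRational_of_isCompositeUniformizable`, p168248, `Theorems/AbhyankarShadowsShadowsUniformizeLurelCompositeUniformizable.lean`): the composite-uniformizable branch from the four c3 stub statements and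
the landed c2 stubs.** Given `O ≤ O₁` with `O₁` Abhyankar / dense-Abhyankar: relative LU for `O₁`
is `relLU_at_abhyankarPlace_of_perfectField` / `lurelDenseAbhyankar`; `κ(O₁)` is generated by
finitely many residues (`stub_residue_gen`); the composition `stub_lurel_of_composite` then asks
for relative LU of `ι⁻¹(O / m_{O₁})` for EVERY `k`-compatible surjective `ι : κ → κ(O₁)` — in the
discrete case this is `stub_composite_residue_discrete` (c2), and in the Abhyankar / dense-Abhyankar
cases the hypothesis, given for ONE such `ι₀ : κ₀ → κ(O₁)`, is moved to `ι` by the transports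
(`hcompat : ι₀ ∘ algebraMap = ι ∘ algebraMap` from the two `k`-compatibilities) and discharged by
`stub_composite_residue_abhyankar` / `stub_composite_residue_dense`.
[cite: NovacoskiSpivakovsky2014, Thm. 1.1; KnafKuhlmann2005, Thm. 1.1; KnafKuhlmann2009, Thm. 1.5] -/
theorem stub_compositeUniformizableAssembly : Sig.stub_compositeUniformizableAssembly := by
  intro hTA hTD hRA hRD p hp k K _ _ _ _ _ hfg O hk hrat hU R hR hRO
  obtain ⟨O₁, hO, hA₁, hres⟩ := hU
  have hk₁ : ∀ c : k, algebraMap k K c ∈ O₁ := fun c => hO (hk c)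
  have hLU₁ : ∀ R : Subalgebra k K, R.FG → R.toSubring ≤ O₁.toSubring →
      ∃ (A : Subalgebra k K) (h : A.toSubring ≤ O₁.toSubring), R ≤ A ∧ A.FG ∧
        IsFractionRing A K ∧ IsRegularLocalRing
          (Localization.AtPrime (Ideal.comap (Subring.inclusion h) (IsLocalRing.maximalIdeal O₁))) := by
    intro R' hR' hR'O
    rcases hA₁ with hA₁ | hD₁
    · exact relLU_at_abhyankarPlace_of_perfectField hfg O₁ hk₁ hA₁ R' hR' hR'O
    · exact lurelDenseAbhyankar p hp k K hfg O₁ hk₁ hD₁ R' hR' hR'O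
  have hgen := stub_residue_gen k K hfg O O₁ hO hk hA₁
  refine stub_lurel_of_composite k K hfg O O₁ hO hk hgen hLU₁ ?_ R hR hRO
  intro κ _ _ ι hι hιk R' hR' hR'O
  rcases hres with hcyc | ⟨κ₀, _, _, ι₀, hι₀, hι₀k, hres₀⟩
  · exact stub_composite_residue_discrete p hp k K O O₁ hO hk hrat hgen hcyc κ ι hι hιk R' hR' hR'O
  · have hcompat : ∀ c : k, ι₀ (algebraMap k κ₀ c) = ι (algebraMap k κ c) := fun c => by
      rw [hι₀k c (hO (hk c)), hιk c]
    rcases hres₀ with hA₀ | hD₀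
    · exact hRA k K O O₁ hO hk hgen κ ι hι hιk
        (hTA k κ₀ κ _ (residueValuationSubring O O₁ hO) ι₀ ι hι₀ hι hcompat hA₀) R' hR' hR'O
    · exact hRD p hp k K O O₁ hO hk hgen κ ι hι hιk
        (hTD k κ₀ κ _ (residueValuationSubring O O₁ hO) ι₀ ι hι₀ hι hcompat hD₀) R' hR' hR'O

/-- **The composite-uniformizable branch** (relative local uniformization at rational places
composed of an Abhyankar / dense-Abhyankar coarsening and a residue valuation that is discrete,
Abhyankar or dense-Abhyankar), from the registered c3 stubs.
[cite: NovacoskiSpivakovsky2014, Thm. 1.1] -/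
theorem lurelCompositeUniformizable : Sig.lurelCompositeUniformizable :=
  stub_compositeUniformizableAssembly stub_isAbhyankarPlace_residue_transport
    stub_isDenseAbhyankar_residue_transport stub_composite_residue_abhyankar
    stub_composite_residue_dense

/-- **`ShadowsUniformize` from the one open-problem stub statement** — the assembly, PROVED:
by cases. (1) On the DISCRETE locus (`IsCyclic (O.ValueGroup)ˣ`) the conclusion is the discrete
branch `lurelDiscrete` (Knaf–Kuhlmann 2009 Thm. 1.5 for `F₀ = k(t)`, PROVED: five landed stubs and
the assembly; the shadow hypothesis is not used — it is free there, disprover finding (B)).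
(2) At an ABHYANKAR place the conclusion is the tree's `relLU_at_abhyankarPlace_of_perfectField`
(Knaf–Kuhlmann 2005 Thm. 1.1; again no shadow needed). (3) On the DENSE-ABHYANKAR locus (`K` in
the completion of an Abhyankar subfunction field `K₀`) it is `lurelDenseAbhyankar` (Knaf–Kuhlmann
2009 Thm. 1.5 in general; lead c2). (4) On the COMPOSITE-UNIFORMIZABLE locus (lead c3, containing
the composite-discrete locus of c2) it is `lurelCompositeUniformizable` (Novacoski–Spivakovsky).
(5) On the REGULAR-CENTRE locus (lead c3 #5: absolute LU with a centre of dimension `≤ 2` on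
some model; all of `k(x, y)`) it is `lurelRegularCentre` (Abhyankar's union lemma).
(6) On the core locus the transfer stub supplies a model with a toric shadow frame and the
landed certifying half `regular_of_shadowFrame` its regularity. [cite: arXiv:2311.12456, p. 5] -/
theorem ShadowsUniformize_of (h₇ : Sig.stub_shadowFrameTransfer_core) : ShadowsUniformize := by
  intro p hp k K _ _ _ _ _ hfg O hk hrat R hR hRO hsh
  by_cases hcyc : IsCyclic (O.ValueGroup)ˣ
  · exact lurelDiscrete p hp k K hfg O hk hrat hcyc R hR hRO
  by_cases hA : IsAbhyankarPlace O (algebraMap k K).fieldRange ⊤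
  · exact relLU_at_abhyankarPlace_of_perfectField hfg O hk hA R hR hRO
  by_cases hD : IsDenseAbhyankar (k := k) O
  · exact lurelDenseAbhyankar p hp k K hfg O hk hD R hR hRO
  by_cases hU : IsCompositeUniformizable (k := k) O
  · exact lurelCompositeUniformizable p hp k K hfg O hk hrat hU R hR hRO
  by_cases hG : HasRegularCentreDimLeTwo (k := k) O
  · exact lurelRegularCentre k K O hG R hR hRO
  · obtain ⟨A, h, hRA, hAfg, hfrac, hframe⟩ :=
      h₇ p hp k K hfg O hk hrat hcyc hA hD hU hG R hR hRO hsh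
    exact ⟨A, h, hRA, hAfg, hfrac, regular_of_shadowFrame k K O A h hAfg hframe⟩

/-- **The crux `ShadowsUniformize`, assembled from the registered stubs** (the only `sorry` in its
closure is the open-problem core `stub_shadowFrameTransfer_core` once the four c3 stubs land; the
discrete, Abhyankar, dense-Abhyankar and composite branches are then kernel-closed). -/
theorem ShadowsUniformize_proof : ShadowsUniformize :=
  ShadowsUniformize_of stub_shadowFrameTransfer_core

end Summit.ResolutionOfSingularities.ResolutionOfSingularities.Cruxes.ShadowsUniformize.Lines.Birth

end
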